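import Mathlib
import HarnessLib
import HarnessLib.Audit
import Summits.CriticalPhenomena.Statement
import Literature.Barriers.CriticalPhenomena.ParafermionicHalfCauchyRiemann
import Literature.Probability.RandomPlanarGeometry.HexSAW
import Literature.Probability.RandomPlanarGeometry.SLEConvergenceCriterion
import Literature.Probability.RandomPlanarGeometry.ConformalMap
import Summits.CriticalPhenomena.SAWScalingLimit.Theorems.SAWMassiveIsingTiltHexEndpointApproxExists
import Summits.CriticalPhenomena.SAWScalingLimit.Theorems.SAWDefectDecoherenceObservableToSLERNestedLinkDefs
import HarnessLib.Audit.Status.Attr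

/-!
Route: SAWResidueField

DORMANT since 2026-08-26T10:52:40Z (reconciler: no traction for 8.3 d (last activity item-evidence-added at 2026-08-18T02:01:51Z); parked, not closed — `ledger route dormant route-CriticalPhenomena-SAWResidueField --off` to reactivate) — unstaffed, not closed; items shared with open routes are served there. `ledger route dormant <id> --off` reactivates.

# Route SAWResidueField — Hodge-split the hexagonal SAW parafermion: DCS Conjecture 2 =
(face-residue Dirichlet energy -> 0) + (limit of the determined discrete-holomorphic part), b
normalised on a flat zigzag edge

It suffices to show X = HexObservableLimitR (rev 6 repair of HexObservableLimit,
stmt-CriticalPhenomena-5420, refuted-misstated by the corridor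
witness SAWDefectDecoherenceHexObservableLimit_refuted: the root must be pinned conformally, not
only Euclidean-ly) — a robust, typed form of
Duminil-Copin–Smirnov 2012 Conjecture 2 on the HEXAGONAL lattice, now the SHARED repaired target
stmt-CriticalPhenomena-14003:
there is one constant c ≠ 0 such that for every Dobrushin domain (Ω; a, b) whose boundary is a
horizontal segment (domain above it) in a ρ-ball
around BOTH marked points, every simply connected hexagonal discretisation Λ_δ (inside Ω, exhausting
compacts, the EXACT row half-lattice of the good
zigzag class inside both ρ-balls),
boundary mid-edges a_δ → a, b_δ → b, and every test function ψ ∈ C_c(Ω): δ² Σ_e ψ(δe) F_δ(e) /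
F_δ(b_δ) → c ∫ ψ (φ'/φ'(b))^(5/8),
F_δ = the DCS parafermionic observable (σ = 5/8, x = x_c) rooted at a_δ, φ : Ω → ℍ with a ↦ ∞, b ↦ 0
(branch exp((5/8)(L − L_b)), L a
continuous log φ'). X is attacked through the card's splitting F_δ = G*_δ + P_δ (P_δ = ℓ²-projection
on the span of the face poles =
the barrier's kernel; G*_δ fully discrete-holomorphic): ResidueEnergyVanishes [R] ∧
HarmonicPartLimitR [H] ⟹ X (SynthesisR), and X feeds
the summit through the shared pipeline ObservableToSLER, HexTight, LatticeUniversality (the last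
verbatim from route SAWHexUniversality);
the final transport to δℤ² (DCS Conjecture 1 on the hexagonal lattice + LatticeUniversality ⟹
SAWScalingLimit) is carried by two routine
SHARED supports, HexEndpointApproxExists (a hexagonal endpoint approximation exists for every
Dobrushin domain with a δℤ² one; ≡ stmt-CriticalPhenomena-9864
of SAWMassiveIsingTilt / SAWDevelopingMap) and SquareTransfer (≡ stmt-CriticalPhenomena-14521 of
SAWDevelopingMap), which replace the dropped HexToSquare
(stmt-CriticalPhenomena-10473, moot since 2026-08-16T03:30Z) — route choice of 2026-08-16, gen-2
review.
Card realised: half-cr-residue-dirichlet-gap (spine).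
Lean: `∃ c : ℂ, c ≠ 0 ∧ ∀ (D : Literature.Probability.RandomPlanarGeometry.DobrushinDomain) (ρ : ℝ)
(Λ : ℝ → Finset Literature.Probability.LatticeModels.HexVertex) (m : Fin 2 → ℝ → ℤ) (a b : ℝ → Sym2
Literature.Probability.LatticeModels.HexVertex) (Φ :
Literature.Probability.RandomPlanarGeometry.ConformalEquiv D.carrier
UpperHalfPlane.upperHalfPlaneSet) (L : ℂ → ℂ) (Lb : ℂ) (ψ : ℂ → ℂ), let F : ℝ → Sym2
Literature.Probability.LatticeModels.HexVertex → ℂ := fun δ z =>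
Literature.Probability.RandomPlanarGeometry.SAW.hexParafermionicObservable (Λ δ) (a δ)
Literature.Probability.RandomPlanarGeometry.SAW.hexCriticalFugacity (5 / 8) z; 0 < ρ → (∀ i : Fin 2,
D.carrier ∩ Metric.ball (D.pt i) ρ = {z : ℂ | (D.pt i).im < z.im} ∩ Metric.ball (D.pt i) ρ) → (∀ᶠ δ
: ℝ in nhdsWithin 0 (Set.Ioi 0),
Literature.Probability.RandomPlanarGeometry.SAW.hexDomainSimplyConnected (Λ δ) ∧ a δ ∈
Literature.Probability.RandomPlanarGeometry.SAW.hexDomainBoundary (Λ δ) ∧ b δ ∈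
Literature.Probability.RandomPlanarGeometry.SAW.hexDomainBoundary (Λ δ) ∧ Nonempty
(Literature.Probability.RandomPlanarGeometry.SAW.HexMidEdgeSAW (Λ δ) (a δ) (b δ)) ∧
(Literature.Probability.LatticeModels.hexGraph.induce ((Λ δ : Finset
Literature.Probability.LatticeModels.HexVertex) : Set
Literature.Probability.LatticeModels.HexVertex)).Preconnected ∧ (∀ v ∈ Λ δ, (δ : ℂ) *
Literature.Probability.LatticeModels.hexCenter v ∈ D.carrier) ∧ (∀ i : Fin 2, ∀ v :
Literature.Probability.LatticeModels.HexVertex, (δ : ℂ) *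
Literature.Probability.LatticeModels.hexCenter v ∈ Metric.ball (D.pt i) ρ → (v ∈ Λ δ ↔ m i δ ≤ v.1
1))) → (∀ K : Set ℂ, IsCompact K → K ⊆ D.carrier → ∀ᶠ δ : ℝ in nhdsWithin 0 (Set.Ioi 0), ∀ v :
Literature.Probability.LatticeModels.HexVertex, (δ : ℂ) *
Literature.Probability.LatticeModels.hexCenter v ∈ K → v ∈ Λ δ) → Filter.Tendsto (fun δ : ℝ => (δ :
ℂ) * Literature.Probability.RandomPlanarGeometry.SAW.hexMidpoint (a δ)) (nhdsWithin 0 (Set.Ioi 0))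
(nhds (D.pt 0)) → Filter.Tendsto (fun δ : ℝ => (δ : ℂ) *
Literature.Probability.RandomPlanarGeometry.SAW.hexMidpoint (b δ)) (nhdsWithin 0 (Set.Ioi 0)) (nhds
(D.pt 1)) → Filter.Tendsto (fun x => ‖Φ x‖) (nhdsWithin (D.pt 0) D.carrier) Filter.atTop →
Φ.HasBoundaryValue (D.pt 1) 0 → ContinuousOn L D.carrier → (∀ z ∈ D.carrier, Complex.exp (L z) =
deriv Φ z) → Filter.Tendsto L (nhdsWithin (D.pt 1) D.carrier) (nhds Lb) → Continuous ψ →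
HasCompactSupport ψ → tsupport ψ ⊆ D.carrier → Filter.Tendsto (fun δ : ℝ => (δ : ℂ) ^ 2 * (∑ᶠ e ∈
Literature.Probability.RandomPlanarGeometry.SAW.hexDomainMidEdges (Λ δ), ψ ((δ : ℂ) *
Literature.Probability.RandomPlanarGeometry.SAW.hexMidpoint e) * F δ e) / F δ (b δ)) (nhdsWithin 0
(Set.Ioi 0)) (nhds (c * ∫ z, ψ z * Complex.exp ((5 / 8 : ℂ) * (L z - Lb))))`

## Assembly
The deciding theorem is pure logic over eight items (gen-2 review of the 2026-08-16 route choice;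
certified native, axioms propext /
Classical.choice / Quot.sound): `closes (hR : ResidueEnergyVanishes) (hH : HarmonicPartLimitR) (hS :
SynthesisR) (hT : HexTight)
(hO : ObservableToSLER) (hE : HexEndpointApproxExists) (hSq : SquareTransfer) (hU :
LatticeUniversality) : SAWScalingLimit :=
hSq hE (hO (hS hR hH) hT) hU` — SynthesisR turns [R] + [H] into the target X, ObservableToSLER turns
X + HexTight into DCS Conjecture 1 on
the hexagonal lattice WRITTEN OUT (derived, never a hypothesis, no by-name conjecture leaf in the
cone), SquareTransfer transports it to δℤ²
with the hexagonal endpoint approximation supplied by HexEndpointApproxExists and the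
LatticeUniversality limit. The three supports in the
chain (SynthesisR: Cauchy–Schwarz + edge-density Riemann sums, M; HexEndpointApproxExists: bulk
hexagonal mesh component accumulates at both
marks, M; SquareTransfer: add two limits on bounded continuous test functions and repack
ConvergesInLawToSLE, S) are provable-now bookkeeping
(SynthesisR refuter-checked, HexEndpointApproxExists grounder- and refuter-stamped on its shared
row, SquareTransfer new at SAWDevelopingMap
rev 9 and batteries-grounded); the open content sits in the five cruxes only. The Assembly ITEM
(stmt-CriticalPhenomena-14084, unchanged: ResidueEnergyVanishes → HarmonicPartLimitR → HexTight →
ObservableToSLER → LatticeUniversality →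
SAWScalingLimit) is the route in one statement and is no longer a hypothesis of `closes`; it follows
from the three supports by the same
term, `fun hR hH hT hO hU => hSq hE (hO (hS hR hH) hT) hU` (Sketch.lean rc 0). CRUX-ONLY RULING
(human, 2026-08-16, live since
rev 14): item hypotheses of `closes` must be of kind crux, so the ledger flags this theorem
`glue.non-crux-hypothesis` for its three SUPPORT
hypotheses (SynthesisR, HexEndpointApproxExists, SquareTransfer) until they are PROVED — that flag
is the transitional normal, not a defect of
the line: the three are provable-now prover obligations (two of them shared rows, one proof serving
2–3 routes), and the moment their `_holds`
theorems land the tenure/repair planner re-submits the crux-only deciding theorem `closes (hR :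
ResidueEnergyVanishes) (hH : HarmonicPartLimitR)
(hT : HexTight) (hO : ObservableToSLER) (hU : LatticeUniversality) : SAWScalingLimit :=
SquareTransfer_holds HexEndpointApproxExists_holds
(hO (SynthesisR_holds hR hH) hT) hU` (`route edit --closes-file`); do NOT re-kind the three supports
as cruxes (5 + 3 = 8 > cap 7 would
re-trigger the hold) and do NOT fold them back into the Assembly item (an assembly-kind hypothesis
is flagged the same way and hides the
shared obligations). Layer 1 (this route's mechanism) = ResidueExists,
KernelIsFacePoles, ResidueEnergyVanishes, HarmonicPartLimitR, SynthesisR; layer 2 (shared pipeline)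
= HexTight, ObservableToSLER,
LatticeUniversality + HexEndpointApproxExists, SquareTransfer.
ROUTE CHOICE (2026-08-16; operator hold smuggled-conjecture: the conjecture-grade non-crux items
HexToSquare + HexObservableLimitR
would have made 8 cruxes > cap 7). Option (a), drop items — gen 1 (rev 13): HexToSquare DROPPED
(graded conjecture-grade through the
'HexConjecture' token of its docstring although grounder- and refuter-stamped provable-now/M; its
content returns as the two token-free
routine supports above) together with HexConjecture (stmt-CriticalPhenomena-0808, crux rank 7,
listed at rev 3 solely as HexToSquare's named
antecedent and referenced by no other decl — DCS Conjecture 1 stays in the cone written out, as the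
conclusion of ObservableToSLER);
HexObservableLimitR KEPT — it is the thesis X itself (frame item #0, kind target, the shared
repaired stmt-CriticalPhenomena-14003, refuter-vetted),
the named conclusion of SynthesisR and antecedent of the shared crux ObservableToSLER; by the target
ruling of 2026-08-16 targets are never
auto-promoted and do not count against the cap. Gen 2 (independent review, this revision): choice
(a) and both drops CONFIRMED; the assembly
re-wired as above so that no item restating 'cruxes ⊢ Statement' is load-bearing and the geometric
lemma the old glue hid (existence of
hexagonal endpoint approximations, grounder note on stmt-10473) is an explicit shared item. Count:
12 items (1 target, 5 cruxes, 5 support,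
1 assembly); 5 cruxes ≤ 7. Option (b), a split into 'layer 1 ⟹ Conjecture 2' and 'Conjecture 2 +
pipeline ⟹ SAWScalingLimit', rejected by
both generations: the first half alone decides the sub-problem only through an assembly X →
SAWScalingLimit that hides HexTight and
LatticeUniversality (worse smuggling), the second half is route SAWHexUniversality plus
ObservableToSLER and discards this route's mechanism,
and no new route may open under the freeze.

Rationale: WHY THIS LINE. Write the mid-edge observable as the complex flow α(v→w) = 3(c_w − c_v)F({v,w}): DCS
Lemma 1 (PROVED in the tree,
DuminilCopinSmirnov2012_lemma1_holds) is Kirchhoff's node law, the missing half of Cauchy–Riemann is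
the face (hexagon) circulation, and
the barrier's kernel (ParafermionicHalfCauchyRiemann_holds, HexKernel.witness = face pole
(1/3)e^(−iθ)) is the cycle space = span of face
poles (support KernelIsFacePoles); so F_δ = G*_δ + Σ_x r_δ(x)·Pole_x exactly, with G*_δ discrete
holomorphic in the Chelkak–Smirnov sense
on the rhombus centres of the isoradial graph ℍ (arXiv:0810.2188 Def. 2.11–2.12: vertex + face
relations = ∂̄ = 0 on Γ ∪ Γ*) and r_δ the
Dirichlet solution of Δr = 9·(face curls). In the continuum dictionary F ≈ A + B e^(−2iθ_e) ↔ ω = A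
dz + B dz̄: the vertex relation makes ω
co-closed, [R] (residue Dirichlet energy = ‖P_δ‖² = o(‖F_δ‖²) on compacts; predicted share ∝ δ²)
makes it closed, hence A holomorphic — DCS's
"we expect that in the limit the curl vanishes, which is equivalent to F_δ(z) having the same limit
regardless of the orientation of the edge"
(arXiv:1007.0575 p. 7) split into a falsifiable interior energy statement and a boundary-driven one,
[H]: the determined gradient part G*_δ
(a discrete derivative of a Neumann-harmonic potential, governed by F's boundary values: argument
exact = DCS's Riemann BVP, modulus = the
boundary SAW two-point function of KennedyLawler2013) converges strongly to c(φ'/φ'(b))^(5/8).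
Imported: discrete Hodge theory / discrete
complex analysis on planar and isoradial graphs (Eckmann 1944, Mercat arXiv:math-ph/0111043, Kenyon
arXiv:math-ph/0202018, Chelkak–Smirnov
arXiv:0810.2188) and the Dirichlet principle; the SLE pipeline of KemppainenSmirnov2017 /
LawlerSchrammWerner2003 / DuminilCopinSmirnov2012Clay.
What prior routes do not do: SAWParafermion states Conj. 2 on ℤ² where no exact relation exists
(not_hasExactVertexRelationZ2) and is BROKEN on
the all-δ tightness 0772 (we use IsTightAlongMesh); SAWHexUniversality quarantines the whole
hexagonal conjecture as one crux (HexConjecture);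
here its observable part is opened into two typed halves with a numerical signature, and the
Kennedy–Lawler normalisation problem at b is
neutralised by a flat good-zigzag boundary piece (all dangling edges parallel and
lattice-equivalent), which an Itô computation shows is
load-bearing (projective observable data fix κ = 8/3 but leave a Girsanov drift free).

RANKED CRUXES. (Rev 6–10 repair: HexObservableLimit stmt-5420 was refuted-misstated by the corridor
witness SAWDefectDecoherenceHexObservableLimit_refuted — root a_δ tied to pt 0 only Euclidean-ly,
Λ_δ free in the o(1)-collar, a boundary-hugging width-1 corridor relocates the conformally effective
root; the repaired items pin the root: flat horizontal boundary + exact row half-lattice in a ρ-ball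
at BOTH marked points, m : Fin 2 → ℝ → ℤ.) #0 HexObservableLimitR (target; the shared repaired item
stmt-14003, also wanted by SAWDefectDecoherence / SAWPhaseRetrieval / SAWDevelopingMap /
SAWWindingAlias) — DCS 2012 Conjecture 2 (hexagonal lattice), averaged against bulk test functions
and normalised at one boundary mid-edge b_δ of a flat good-zigzag boundary piece, the root a_δ on a
flat lattice-pinned piece as well: ∃ c ≠ 0 universal with δ²⟨ψ, F_δ⟩/F_δ(b_δ) → c ∫ ψ exp((5/8)(L −
L_b)) for every Dobrushin domain flat (horizontal, domain above) near a AND near b, every admissible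
discretisation family (simply connected, connected, inside Ω, exhausting compacts, rows y₁ ≥ m_i(δ)
inside ball(pt i, ρ) for i = 0, 1), a_δ → a, b_δ → b boundary mid-edges, φ: a ↦ ∞, b ↦ 0, L = log φ'
continuous with L → L_b at b, ψ ∈ C_c(Ω). (why it might fail: Needs BOTH interior closedness [R] and
conformally covariant boundary data [H]; single-edge normalisation F(b_δ) is lattice-universal only
for the good zigzag class (built in); the collar away from a, b stays free (lattice-scale
decorations, o(1)-receding flat pieces — believed invisible after normalisation, unproved); Conj. 2
is open since 2010 and fails if the limit 1-form A dz + B dz̄ keeps B ≠ 0 or A non-holomorphic.)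
[DuminilCopinSmirnov2012, arXiv:1007.0575, Smirnov2007ICM, KennedyLawler2013, arXiv:0810.2188]
#2 ResidueEnergyVanishes (crux) — [R] (card r2, localised): for every Dobrushin domain, admissible
discretisation family Λ_δ (simply connected, connected, inside Ω, exhausting compacts) and boundary
roots a_δ → a, if r_δ is the residue potential of F_δ (P_δ := Σ_(full x) r_δ(x)·HexKernel.witness x
with ⟨F_δ − P_δ, witness x⟩ = 0 for every full hexagon x), then on every compact K ⊂ Ω the pole
energy Σ_(e∈K) |P_δ(e)|² is eventually ≤ ε Σ_(e∈K) |F_δ(e)|², for every ε > 0 ("the face-curl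
carries no energy in the limit"; predicted share ∝ δ²). [difficulty: open-problem] (why it might
fail: The orientation-averaged observable (A in F ≈ A + B e^{-2iθ}) may fail to be holomorphic in
the limit: then the co-exact part keeps a fixed share of the local energy instead of the predicted
O(δ²); no bound on the two-walk interference sums Σ x_c^{|γ|+|γ'|} e^{-iσ(W-W')} is in print.)
[DuminilCopinSmirnov2012, DuminilCopin2013Parafermion, arXiv:0810.2188,
Literature.Barriers.CriticalPhenomena.ParafermionicHalfCauchyRiemann, IkhlefCardy2009]
#3 HarmonicPartLimitR (crux, stmt-14055; rev-6 repair of 5422, which carried the refuted hypothesis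
block) — [H] (card r3+r4 merged): in the setting of the repaired target (flat good-zigzag boundary
and exact half-lattice at a and at b, b_δ → b, a_δ → a) there is one c ≠ 0 such that the fully
discrete-holomorphic part G*_δ = F_δ − P_δ, normalised by F_δ(b_δ), converges to c·exp((5/8)(L −
L_b)) STRONGLY in L² on compacts: δ² Σ_(e∈K) |G*_δ(e)/F_δ(b_δ) − c e^((5/8)(L(δe) − L_b))|² → 0 (no
staggered dz̄-component, constant identified) — a discrete Riemann–Hilbert/Neumann problem of Ising
type for a DETERMINED function, Chelkak–Smirnov toolbox. [deps: ResidueEnergyVanishes] [difficulty: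
open-problem] (why it might fail: G*_δ is fixed by F's BOUNDARY values: argument exact (DCS Riemann
BVP) but modulus = boundary SAW two-point function with Kennedy–Lawler lattice factors; strong L²
convergence to c(φ'/φ'(b))^{5/8} with no staggered dz̄-part is boundary conformal covariance, open;
CS theory gives only precompactness.) [arXiv:0810.2188, ChelkakSmirnov2012Ising, KennedyLawler2013,
DuminilCopinSmirnov2012, BeatonGuttmannJensen2012, arXiv:1109.3091]
#4 HexTight (crux) — eventual tightness of the critical hexagonal SAW laws: for every Dobrushin
domain and hexagonal endpoint approximation (IsEmbEndpointApprox hexGraph hexCenter), the family δ ↦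
hexSAWLaw pushed to CurveClass ℂ is tight along 𝓝[>]0 (IsTightAlongMesh — NOT the refuted all-δ
IsTightLaws form of stmt-CriticalPhenomena-0772). [difficulty: open-problem] (why it might fail: No
RSW/annulus-crossing technology for SAW (n = 0: no FKG; KS17 §4 covers FK, percolation, harmonic
explorer, LERW; G2 fails for UST §4.5); strongest inputs: sub-ballisticity (DCH13,
arXiv:2310.17299). Eventual form avoids refuted all-δ item 0772.) [KemppainenSmirnov2017,
DuminilCopinHammond2013, arXiv:2310.17299, arXiv:1212.6215,
Summit.CriticalPhenomena.SAWScalingLimit.Theorems.SAWParafermionTight_refuted]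
#5 ObservableToSLER (crux, the shared stmt-14005; rev-6 rewiring of 10472, which became vacuous when
its antecedent was refuted) — the martingale-observable identification for the hexagonal SAW:
HexObservableLimitR → HexTight → (DCS 2012 Conjecture 1 on the hexagonal lattice written out — the
content of the shared item HexConjecture stmt-0808, rfl-equal to Literature HexSAWScalingLimit; no
longer an item of this route since the 2026-08-16 route choice): the b-normalised observable ⟨ψ,
F_(Ω∖γ[0,n])⟩/F_(Ω∖γ[0,n])(b) is an exact discrete martingale (domain Markov property of the SAW),
its limit c⟨ψ,(φ_n'/φ_n'(b))^(5/8)⟩ forces the driving process of every subsequential limit to be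
√(8/3)B (LSW03 Prop. 5.2 / Itô on g_t'^(5/8)(g_t − W_t)^(−5/4)), and tightness + uniqueness of the
SLE law conclude (SLEConvergenceCriterion). [deps: HexObservableLimitR, HexTight] [difficulty: XL]
(why it might fail: The martingale ⟨ψ,F_{Ω_n}⟩/F_{Ω_n}(b) needs the observable limit in the SAW's
own slit domains, uniformly (Carathéodory), and rough b; HexObservableLimitR is per fixed Jordan
domain, flat and lattice-pinned at a and b. Projective data fix κ = 8/3 but not the drift, so the
b-normalisation is load-bearing.) [LawlerSchrammWerner2003, KemppainenSmirnov2017,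
DuminilCopinSmirnov2012Clay, Smirnov2007ICM, DuminilCopinSmirnov2012, arXiv:math/0209343]
#6 LatticeUniversality (crux) — shared verbatim with route SAWHexUniversality (its rank-2 crux,
stmt-CriticalPhenomena-0807): for every Dobrushin domain, square-lattice endpoint approximation and
hexagonal one, the critical ℤ² SAW law and the critical hexagonal SAW law become asymptotically
equal in law on CurveClass ℂ (difference of bounded continuous test integrals → 0 as δ → 0+); this
route reaches δℤ² only through it. [difficulty: open-problem] (why it might fail: Uniform Z² SAW is
in no Yang–Baxter/integrable family (GM19 p.1; barrier NienhuisWeightsExcludeVertexSAW): no transfer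
tool reaches it; lattice effects persist in limits of boundary SAW ensembles (KennedyLawler2013);
typed 'P^Z2 − P^Hex → 0' needs tightness of both, open.) [GlazmanManolescu2019, KennedyLawler2013,
DuminilCopinSmirnov2012, Literature.Barriers.CriticalPhenomena.NienhuisWeightsExcludeVertexSAW,
Literature.Barriers.CriticalPhenomena.not_hasExactVertexRelationZ2]
(dropped 2026-08-16, route choice, gen 1; confirmed gen 2) HexConjecture
(stmt-CriticalPhenomena-0808; was crux rank 7) — DCS 2012 Conjecture 1 on the hexagonal lattice,
listed at rev 3 only as the named antecedent of HexToSquare; no decl names it any more, its content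
remains in the cone written out as the conclusion of ObservableToSLER (derived from items 0, 4, 5,
never a hypothesis); the shared item keeps its other routes. (dropped 2026-08-16, route choice, gen
1; confirmed gen 2) HexToSquare (stmt-CriticalPhenomena-10473; was support; moot since 03:30Z, every
sibling dropped or re-filed it) — the layer-2 transport; graded conjecture-grade through the
'HexConjecture' token of its docstring; replaced (gen 2) by the two token-free routine supports
HexEndpointApproxExists + SquareTransfer below. [DuminilCopinSmirnov2012, GlazmanManolescu2019]
#9 ResidueExists (support) — linear algebra: for every finite vertex set Λ and every function G on
mid-edges there is a residue potential r (orthogonality of G − Σ_(full x) r(x)·witness x to every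
face pole of a full hexagon) — equivalently the face poles HexKernel.witness x of distinct hexagons
are linearly independent (peel an extremal hexagon); gives existence (and, with the same argument,
uniqueness) of the splitting F = G* + P and Pythagoras. [difficulty: provable-now]
[Literature.Barriers.CriticalPhenomena.ParafermionicHalfCauchyRiemann, arXiv:0810.2188]
#9 KernelIsFacePoles (support) — the barrier's kernel identified (card item r5): for a simply
connected hexagonal domain Λ (connected complement), every function satisfying all DCS vertex
relations on Λ, supported on the domain's mid-edges and vanishing on the boundary mid-edges, is a
linear combination of the face poles HexKernel.witness x of the FULL hexagons of Λ (flow picture: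
kernel = cycle space Z₁ of the plane graph (Λ, interior edges), whose bounded faces are single
hexagons because the complement is connected; face cycles span Z₁). [difficulty: M]
[Literature.Barriers.CriticalPhenomena.ParafermionicHalfCauchyRiemann, DuminilCopinSmirnov2012,
arXiv:math-ph/0111043]
#9 SynthesisR (support, stmt-14066) — glue of layer 1: ResidueEnergyVanishes → HarmonicPartLimitR →
HexObservableLimitR (pick a residue selection by the support ResidueExists; Cauchy–Schwarz: |δ²Σψ(F
− G*)| ≤ (δ²Σ|ψ|²)^(1/2)(δ²Σ_K|P|²)^(1/2) and δ²Σ_K|P|² ≤ 2ε/(1−2ε)·δ²Σ_K|G*|², bounded by [H];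
edge-density Riemann sums δ²Σ_e g(δ·mid e) → 2√3 ∫ g give the target's constant 2√3·c). [difficulty:
M] [arXiv:0810.2188, DuminilCopinSmirnov2012]
#9 HexEndpointApproxExists (support, gen-2 review; ≡ stmt-CriticalPhenomena-9864 of
SAWMassiveIsingTilt / SAWDevelopingMap by signature) — every Dobrushin domain with a δℤ² endpoint
approximation admits a hexagonal one: IsEndpointApprox D a b → ∃ a′ b′, IsEmbEndpointApprox hexGraph
hexCenter D a′ b′ (the bulk component of the hexagonal mesh graph accumulates at both marks;
template: the PROVED ℤ² twin SAW.exists_isEndpointApprox; disc engine already in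
Theorems/HexConjecture/Negative/NonVacuity.lean) — the geometric lemma the old glue hid (grounder
note on stmt-10473). [difficulty: M, provable now] [DuminilCopinSmirnov2012,
LawlerSchrammWerner2004SAW]
#9 SquareTransfer (support, gen-2 review; ≡ stmt-CriticalPhenomena-14521 of SAWDevelopingMap by
signature) — [HexEndpointApproxExists written out] → [hexagonal SLE(8/3) convergence for every
Dobrushin domain and hexagonal endpoint approximation, written out = ObservableToSLER's conclusion]
→ LatticeUniversality → SAWScalingLimit: pick the hexagonal approximation, take the SLE(8/3) curve Γ
of the hexagonal limit, add ∫ f∘curve d(P^{ℤ²}_δ − P^{Hex}_δ) → 0 to ∫ f∘curve dP^{Hex}_δ → E f(Γ)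
for bounded continuous f, AEMeasurable from the discrete σ-algebra, repack ConvergesInLawToSLE.
[difficulty: S, provable now] [DuminilCopinSmirnov2012, GlazmanManolescu2019]

TWO-LAYER PLAN. Foreseen glued splits once a crux moves (k ≤ 3, depth 1): HarmonicPartLimitR ⇐
BoundaryFluxCovariance (the complex boundary flux
Σ_(e∈arc) 3d_e F_δ(e)/F_δ(b_δ) → c'∫_arc (φ'/φ'(b))^(5/8) dz on arcs with smooth boundary) →
NeumannGradientConvergence (discrete
potential theory on ℍ: gradients of Neumann/Dirichlet-harmonic functions with weakly converging data
converge in L²_loc, arXiv:0810.2188 §3)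
→ HarmonicPartLimitR; ResidueEnergyVanishes ⇐ CurlIsMesoscopicallySmall (Σ_x χ(δx)·curl_δ(x) = o(δ⁻¹
F_δ(b_δ)) for smooth χ, i.e. weak
holomorphicity of the orientation-averaged observable) → LocalEnergyRegularity (δ-uniform
comparability of Σ_K|F_δ|² across compacts, a
Harnack-type statement for SAW generating functions) → ResidueEnergyVanishes; ObservableToSLER ⇐
SlitUniformObservable (the target uniformly
over discrete slit sub-domains sharing the flat piece at b, Carathéodory topology) →
LoewnerRegularity (KS Condition G2-type input beyond
tightness) → ObservableToSLER.

KILL CRITERIA. ¬ResidueEnergyVanishes exhibited for an honest discretisation family (energy share of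
the face-residue field bounded below on a compact)
refutes DCS Conjecture 2 in averaged form for that family and closes the route (`close --reason
refuted:ResidueEnergyVanishes`), handing the
witness to SAWHexUniversality/SAWParafermion as negative knowledge. ¬HarmonicPartLimitR with [R]
standing ⇒ pivot: restate [H] with the
boundary ARGUMENT condition only (Riemann BVP Im(F·τ^(5/8)) = 0, conformally meaningful on rough
boundaries) or with flux normalisation on
an arc instead of the edge b_δ. ¬HexObservableLimitR by a further collar degeneracy (a
bridge/appendage carrying a_δ or b_δ, receding flat pieces) ⇒ restate with the canonical
discretisation v ∈ Λ_δ ↔ δc_v ∈ Ω outside the two balls; a provably δ-oscillating constant ⇒ c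
depending on the discrete class at b; if no normalisation survives, close. History:
¬HexObservableLimit (stmt-5420, corridor witness, 2026-08-15) ⇒ repaired as above (rev 6–10).
¬HexTight or ¬LatticeUniversality are conjunct-level events shared with the sibling
routes (SAWHexUniversality breaks too). HexConjecture (stmt-0808, not an item here since the
2026-08-16 route choice) proved elsewhere moots items 0–5 (closes then needs only
LatticeUniversality + the two routine supports); ¬HexConjecture kills the line in substance (one of
X, HexTight, ObservableToSLER is false) although the route is no longer attached to 0808 — the
tenure planner watches `ledger negatives`; SAWScalingLimit proved on ℤ² directly
moots everything.

NOT DECOMPOSED YET. The boundary side of [H] (flux vs argument formulation; Kennedy–Lawler factors;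
which arcs), the discrete potential theory on ℍ (Neumann
vs the dual Dirichlet problem on 𝕋), the edge-density Riemann sums and the L²-bookkeeping inside
SynthesisR, the Carathéodory-uniform /
slit-domain version of the target and the treatment of rough a and b (inside ObservableToSLER), the
KS Loewner-regularity input, discretisation
conventions (ℍ-adjacency of HexMidEdgeSAW vs the segment rule of hexSAWLaw; mid-edge vs vertex
endpoints; the hexagonal endpoint existence now being the explicit support HexEndpointApproxExists),
and every constant (c, the 2√3 edge density, the δ² rate) — all layer-2 children, later.

CHEAPEST FALSIFIER. Exact linear algebra on exactly enumerated data: compute F_δ (σ = 5/8, x = x_c)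
by SAW enumeration/transfer matrix in hexagonal rhombi or
discs of 6–14 lattice units rooted at a boundary mid-edge, solve the sparse Dirichlet system for the
residue potential r (one unknown per
hexagon), and tabulate the energy share Σ_K|P|²/Σ_K|F|² on a fixed interior window K against the
size L: the line predicts decay ∝ L⁻²
(share → 0); a plateau kills ResidueEnergyVanishes and with it the averaged Conjecture 2 for that
geometry. The same run tests [H]
independently: G* = F − P against c(φ'/φ'(b))^(5/8) for the explicit rhombus/disc map, and whether
G*'s three edge classes agree (no
staggered part). Not run here (planner, one-shot); it is a kit job of a few CPU-hours.

NUMBERS. σ = 5/8, x_c = 1/√(2+√2) (DuminilCopinSmirnov2012 Thm 1, Lemma 1 — both PROVED in the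
tree); face pole values (1/3)e^(−iπ(k+1)/3) on the
six edges (HexKernel.val, verified); kernel dimension = number of full hexagons = E_int − V + 1 ≈
E/3 (DCS count "(2/3)E relations for E
unknowns"); edge density of the unit honeycomb 2√3 per unit area (hexagon area √3/2, 3 edges each);
predicted residue-energy share ∝ δ²
(curl per hexagon O(δ²·F) when the averaged observable is holomorphic, O(δ·F) otherwise); boundary
scaling F_δ(b_δ) ~ δ^(5/4) (boundary
weight 5/8), bulk two-point decay r^(−5/4) near a; κ = 8/3 from 2β + κβ(β−1)/2 = 2α with (α, β) =
(5/8, −5/4); competitor RH solution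
(φ')^(11/8) dz̄-type is subleading by δ^(3/2). Item census: at open 11; rev 3 12 (+ HexConjecture,
glue restated over it); rev 6–10 repair 12 (target 5420 refuted-misstated → 14003, [H] and the glues
restated, Assembly stated with content); route choice gen 1 (rev 13) 10 (HexToSquare, HexConjecture
dropped; closes = modus ponens of Assembly); gen-2 review 12 items (1 target, 5 cruxes —
ResidueEnergyVanishes, HarmonicPartLimitR, HexTight, ObservableToSLER, LatticeUniversality —, 5
support — SynthesisR, ResidueExists, KernelIsFacePoles, HexEndpointApproxExists, SquareTransfer —, 1
assembly), 5 cruxes ≤ cap 7, used-constants cone clean; deciding theorem closes (hR) (hH) (hS) (hT)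
(hO) (hE) (hSq) (hU) := hSq hE (hO (hS hR hH) hT) hU (pure logic, Sketch.lean rc 0, axioms
standard).

DEFINITION REQUESTS. None required: every statement is self-contained over HexParafermion.lean,
HexSAW.lean, the barrier file's HexKernel (witness/edge/val/
hexagonFaces), ConformalEquiv and IsTightAlongMesh (all `lean search`-verified; Sketch.lean
elaborates, rc 0). Optional convenience for
provers (not filed): `hexFacePoleProjection Λ G` / `hexResiduePotential Λ G` in
Literature/Probability/RandomPlanarGeometry/HexParafermion
to abbreviate the inline `let pole/pair` blocks.

Novelty: Searches (2026-08-15): `lit search --hybrid "parafermionic observable self-avoiding walk scaling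
limit discrete holomorphic curl"` (12 book
hits: Madras–Slade, Lawler, Slade — none on the mechanism); `lit search --source zbmath
"parafermionic observable self-avoiding walk"` (3:
DuminilCopinSmirnov2012, DuminilCopin2013Parafermion, Glazman2015WeightedSAW); zbmath "discrete
holomorphic observable divergence-free curl
O(n)" (0); `lit frontier CriticalPhenomena --since 2020` (30 rows; SAW-relevant: arXiv:2310.17299
sub-ballisticity); `lit citing
arXiv:1007.0575` (158 citing works scanned, none completing the Cauchy–Riemann relations for the SAW
observable); `lit galaxy search
"parafermionic observable" --star all` (7 rows: DuminilCopin2013Parafermion, DCM fractal FK paper,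
and arXiv:2409.03235 — Zhou's claimed
completion of half-CR for BOND PERCOLATION on ℤ² via rotational invariance and two auxiliary edge
observables, a different mechanism,
unrefereed); `lit vsearch` on the Hodge/curl phrasing (noise only); reads: arXiv:1007.0575 p. 7
(curl remark, Riemann BVP, Conj. 2),
arXiv:0810.2188 pp. 8, 11 (Def. 2.11–2.12, averaged convergence of discrete holomorphic functions),
barrier files ParafermionicHalfCauchyRiemann
/ FKParafermionicHalfCauchyRiemann, all six sibling route files; OpenAlex/S2/arXiv APIs rate-limited
today (429). The card's refuter audit
(2026-08-15) had read Smirnov ICM 2010 (arXiv:1009.6077) §2, §5, Q3/Q5.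
Nearest prior art found: DuminilCopinSmirnov2012 §4 (arXiv:  [refs: 2310.17299, 1007.0575, 2409.03235, 0810.2188, 1009.6077, math-ph/0111043, math-ph/0202018, DuminilCopinSmirnov2012, KennedyLawler2013]

Barriers (technique_class: parafermionic-observable discrete-hodge dirichlet-energy): - technique_class: parafermionic-observable discrete-hodge dirichlet-energy
- Literature.Barriers.CriticalPhenomena.ParafermionicHalfCauchyRiemann: APPLIES head-on and is the
starting point — its kernel witness HexKernel.witness is our face pole and KernelIsFacePoles says
the kernel is exactly their span (cycle space). Evaded in statement: nothing here determines F_δ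
from vertex relations + boundary values (the barrier's class); G*_δ IS determined (a projection),
and the difference F_δ − G*_δ is controlled by an ENERGY statement about the SAW ([R]) that lies
outside the class; honest: if [R] is false the barrier wins in the strong sense and only the
gradient (Bergman) part of weak limits is identified.
- Literature.Barriers.CriticalPhenomena.FKParafermionicHalfCauchyRiemann: same structure for the FK
parafermion, q ≠ 2 (kernel = closed discrete forms / zero boundary flux); our splitting applies
there verbatim — a by-product and a second test-bed (q = 1, σ = 1/3, where arXiv:2409.03235 claims a
different completion), not an evasion claim.
- Literature.Barriers.CriticalPhenomena.FKParafermionicHalfCauchyRiemannNarrow: its sharpened class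
is `halfCRSolutions` = closed discrete forms used ONLY as exact lattice identities + boundary
values, and it blocks discrete-level DETERMINATION of F_δ only; this route is precisely of its
NOT-blocked type (b): the vertex relations are used as Kirchhoff's law, F_δ is never determined from
them (G*_δ is a projection, determined by construction),

History (route lifecycle, newest last):
- 2026-08-16T00:03:21Z · rev 5: dropped stmt-CriticalPhenomena-13997, stmt-CriticalPhenomena-14007, stmt-CriticalPhenomena-14005, stmt-CriticalPhenomena-14008 — repair step 0: detach the four items I attached with bare `workitem add` (no decl_name/kind recorded on the wanted_by entry: 13997 HexObservableLimitR m/m0-form (planner-rrefute-CriticalPhenomena-SAWResidueFi-91b99e2d-0)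
- 2026-08-16T00:10:46Z · rev 6: restated HexObservableLimit (stmt-CriticalPhenomena-5420 refuted), HarmonicPartLimit (stmt-CriticalPhenomena-5422), ObservableToSLE (stmt-CriticalPhenomena-10472) — repair step A: HexObservableLimit (stmt-5420) refuted-misstated by SAWDefectDecoherenceHexObservableLimit_refuted — 1:1 restates HexObservableLimit  (planner-rrefute-CriticalPhenomena-SAWResidueFi-91b99e2d-0)
- 2026-08-16T00:11:33Z · rev 7: restated Synthesis (stmt-CriticalPhenomena-5427) — repair step B: Synthesis (stmt-5427, whose conclusion was the refuted HexObservableLimit) → SynthesisR := ResidueExists ∧ ResidueEnergyVanishes ∧ HarmonicPartLi (planner-rrefute-CriticalPhenomena-SAWResidueFi-91b99e2d-0)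
- 2026-08-16T00:13:43Z · rev 8: restated SynthesisR (stmt-CriticalPhenomena-14056) — repair step B2: SynthesisR (stmt-14056) was rendered BLOCKED (supports are ordered by item id, so it precedes ResidueExists stmt-5425 in the file); restated as (planner-rrefute-CriticalPhenomena-SAWResidueFi-91b99e2d-0)
- 2026-08-16T00:14:18Z · rev 9: restated Assembly (stmt-CriticalPhenomena-5429) — repair step C (final): Assembly rewired over the repaired items; deciding theorem restored WITH CONTENT — closes : SynthesisR → ResidueEnergyVanishes → Harmonic (planner-rrefute-CriticalPhenomena-SAWResidueFi-91b99e2d-0)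
- 2026-08-16T00:16:05Z · rev 10: restated Assembly (stmt-CriticalPhenomena-14067) — ground repair: Assembly (stmt-14067, pure-logic chain = closes, flagged ground.trivial/blocking; the gate refuses to drop an assembly) restated WITH CONTENT as (planner-rrefute-CriticalPhenomena-SAWResidueFi-91b99e2d-0)
- 2026-08-16T03:07:07Z · rev 13: dropped HexToSquare, HexConjecture — route-choice (operator hold smuggled-conjecture: 2 conjecture-grade non-crux items would make 8 cruxes > cap 7): option (a) DROP ITEMS — dropped HexToSquare (su (planner-rchoice-CriticalPhenomena-SAWResidueFi-57937f86-0)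
- 2026-08-26T10:52:40Z · DORMANT — reconciler: no traction for 8.3 d (last activity item-evidence-added at 2026-08-18T02:01:51Z); parked, not closed — `ledger route dormant route-CriticalPhenomen (operator:999:2460421)

sub-problem: SAWScalingLimit · status: dormant · opened planner-plancard-CriticalPhenomena-SAWScaling-a6e86a2c-0 2026-08-15T11:41:06Z · rev 17 · ledger route-CriticalPhenomena-SAWResidueField
GENERATED by the gate from the ledger (D-0016/17). Provers cite these decls: `theorem foo : Summit.CriticalPhenomena.SAWScalingLimit.Theses.SAWResidueField.<Decl> := …` in Summits/CriticalPhenomena/SAWScalingLimit/Theorems/<Name>.lean.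
-/

namespace Summit.CriticalPhenomena.SAWScalingLimit.Theses.SAWResidueField

open scoped BigOperators Topology Manifold Classical MeasureTheory ProbabilityTheory Matrix InnerProductSpace ComplexConjugate ContinuousMap
open Filter Set Function TopologicalSpace MeasureTheory

attribute [summit_statement] _root_.SAWScalingLimit

/-- item stmt-CriticalPhenomena-14003 · target · rank 0 · open · by planner
why it might fail: Conj. 2 open since 2010: the limit 1-form A dz + B dz̄ may keep B ≠ 0 or A non-holomorphic (half of discrete CR only); the collar away from a, b stays free (believed invisible after normalisation, unproved); root relocation now needs a channel through the rigid ρ-ball, excluded.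
sources: DuminilCopinSmirnov2012, arXiv:1007.0575, Smirnov2007ICM, KennedyLawler2013, arXiv:0810.2188, Summit.CriticalPhenomena.SAWScalingLimit.Theorems.SAWDefectDecoherenceHexObservableLimit_refuted
[target] repaired HexObservableLimit (stmt-CriticalPhenomena-5420, refuted-misstated by
Summit.CriticalPhenomena.SAWScalingLimit.Theorems.SAWDefectDecoherenceHexObservableLimit_refuted —
the corridor witness: with Λ_δ free in the o(1)-collar at ∂Ω a boundary-hugging width-1 corridor
with a moat relocates the conformally effective root (3/4 → 1/2 on the half-disc) while every old
hypothesis holds, so the universal c ≠ 0 forces z(p−q)(1−pq) = 0). DCS 2012 Conjecture 2 (hexagonal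
lattice), averaged against bulk test functions ψ ∈ C_c(Ω) and normalised at one boundary mid-edge
b_δ, with the ROOT PINNED CONFORMALLY exactly as b already was: for BOTH marked points p_i (i = 0
the root a, i = 1 the normalisation point b) the domain is the horizontal half-plane piece {im z >
im p_i} inside the ball B(p_i, ρ) and the discretisation is the exact half-lattice there (v ∈ Λ_δ ↔
row(v) ≥ m_i(δ)); otherwise as before — ∃ c ≠ 0 universal with δ²⟨ψ, F_δ⟩/F_δ(b_δ) → c ∫ ψ
exp((5/8)(L − L_b)) for every such Dobrushin domain, every admissible discretisation family (simply
connected, connected, inside Ω, exhausting compacts), boundary mid-edges a_δ → a, b_δ → b, φ: a ↦ ∞,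
b ↦ 0, L = log φ' continuous wi -/
@[route_item "route-CriticalPhenomena-SAWResidueField"]
def HexObservableLimitR : Prop :=
  ∃ c : ℂ, c ≠ 0 ∧ ∀ (D : Literature.Probability.RandomPlanarGeometry.DobrushinDomain) (ρ : ℝ) (Λ : ℝ → Finset Literature.Probability.LatticeModels.HexVertex) (m : Fin 2 → ℝ → ℤ) (a b : ℝ → Sym2 Literature.Probability.LatticeModels.HexVertex) (Φ : Literature.Probability.RandomPlanarGeometry.ConformalEquiv D.carrier UpperHalfPlane.upperHalfPlaneSet) (L : ℂ → ℂ) (Lb : ℂ) (ψ : ℂ → ℂ), let F : ℝ → Sym2 Literature.Probability.LatticeModels.HexVertex → ℂ := fun δ z => Literature.Probability.RandomPlanarGeometry.SAW.hexParafermionicObservable (Λ δ) (a δ) Literature.Probability.RandomPlanarGeometry.SAW.hexCriticalFugacity (5 / 8) z; 0 < ρ → (∀ i : Fin 2, D.carrier ∩ Metric.ball (D.pt i) ρ = {z : ℂ | (D.pt i).im < z.im} ∩ Metric.ball (D.pt i) ρ) → (∀ᶠ δ : ℝ in nhdsWithin 0 (Set.Ioi 0), Literature.Probability.RandomPlanarGeometry.SAW.hexDomainSimplyConnected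 (Λ δ) ∧ a δ ∈ Literature.Probability.RandomPlanarGeometry.SAW.hexDomainBoundary (Λ δ) ∧ b δ ∈ Literature.Probability.RandomPlanarGeometry.SAW.hexDomainBoundary (Λ δ) ∧ Nonempty (Literature.Probability.RandomPlanarGeometry.SAW.HexMidEdgeSAW (Λ δ) (a δ) (b δ)) ∧ (Literature.Probability.LatticeModels.hexGraph.induce ((Λ δ : Finset Literature.Probability.LatticeModels.HexVertex) : Set Literature.Probability.LatticeModels.HexVertex)).Preconnected ∧ (∀ v ∈ Λ δ, (δ : ℂ) * Literature.Probability.LatticeModels.hexCenter v ∈ D.carrier) ∧ (∀ i : Fin 2, ∀ v : Literature.Probability.LatticeModels.HexVertex, (δ : ℂ) * Literature.Probability.LatticeModels.hexCenter v ∈ Metric.ball (D.pt i) ρ → (v ∈ Λ δ ↔ m i δ ≤ v.1 1))) → (∀ K : Set ℂ, IsCompact K → K ⊆ D.carrier → ∀ᶠ δ : ℝ in nhdsWithin 0 (Set.Ioi 0), ∀ v : Literature.Probability.LatticeModels.HexVertex, (δ : ℂ) * Literature.Probability.LatticeModels.hexCenter v ∈ K → v ∈ Λ δ) → Filter.Tendsto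 (fun δ : ℝ => (δ : ℂ) * Literature.Probability.RandomPlanarGeometry.SAW.hexMidpoint (a δ)) (nhdsWithin 0 (Set.Ioi 0)) (nhds (D.pt 0)) → Filter.Tendsto (fun δ : ℝ => (δ : ℂ) * Literature.Probability.RandomPlanarGeometry.SAW.hexMidpoint (b δ)) (nhdsWithin 0 (Set.Ioi 0)) (nhds (D.pt 1)) → Filter.Tendsto (fun x => ‖Φ x‖) (nhdsWithin (D.pt 0) D.carrier) Filter.atTop → Φ.HasBoundaryValue (D.pt 1) 0 → ContinuousOn L D.carrier → (∀ z ∈ D.carrier, Complex.exp (L z) = deriv Φ z) → Filter.Tendsto L (nhdsWithin (D.pt 1) D.carrier) (nhds Lb) → Continuous ψ → HasCompactSupport ψ → tsupport ψ ⊆ D.carrier → Filter.Tendsto (fun δ : ℝ => (δ : ℂ) ^ 2 * (∑ᶠ e ∈ Literature.Probability.RandomPlanarGeometry.SAW.hexDomainMidEdges (Λ δ), ψ ((δ : ℂ) * Literature.Probability.RandomPlanarGeometry.SAW.hexMidpoint e) * F δ e) / F δ (b δ)) (nhdsWithin 0 (Set.Ioi 0)) (nhds (c * ∫ z, ψ z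 * Complex.exp ((5 / 8 : ℂ) * (L z - Lb))))

/-- item stmt-CriticalPhenomena-5421 · crux · rank 2 · open · by planner
why it might fail: The orientation-averaged observable (A in F ≈ A + B e^{-2iθ}) may fail to be holomorphic in the limit: then the co-exact part keeps a fixed share of the local energy instead of the predicted O(δ²); no bound on the two-walk interference sums Σ x_c^{|γ|+|γ'|} e^{-iσ(W-W')} is in print.
sources: DuminilCopinSmirnov2012, DuminilCopin2013Parafermion, arXiv:0810.2188, Literature.Barriers.CriticalPhenomena.ParafermionicHalfCauchyRiemann, IkhlefCardy2009
[crux] [R] (card r2, localised): for every Dobrushin domain, admissible discretisation family Λ_δ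
(simply connected, connected, inside Ω, exhausting compacts) and boundary roots a_δ → a, if r_δ is
the residue potential of F_δ (P_δ := Σ_(full x) r_δ(x)·HexKernel.witness x with ⟨F_δ − P_δ, witness
x⟩ = 0 for every full hexagon x), then on every compact K ⊂ Ω the pole energy Σ_(e∈K) |P_δ(e)|² is
eventually ≤ ε Σ_(e∈K) |F_δ(e)|², for every ε > 0 ("the face-curl carries no energy in the limit";
predicted share ∝ δ²). [difficulty: open-problem] -/
@[route_item "route-CriticalPhenomena-SAWResidueField", crux]
def ResidueEnergyVanishes : Prop :=
  ∀ (D : Literature.Probability.RandomPlanarGeometry.DobrushinDomain) (Λ : ℝ → Finset Literature.Probability.LatticeModels.HexVertex) (a : ℝ → Sym2 Literature.Probability.LatticeModels.HexVertex) (r : ℝ → Literature.Probability.LatticeModels.Site 2 → ℂ), let F : ℝ → Sym2 Literature.Probability.LatticeModels.HexVertex → ℂ := fun δ z => Literature.Probability.RandomPlanarGeometry.SAW.hexParafermionicObservable (Λ δ) (a δ) Literature.Probability.RandomPlanarGeometry.SAW.hexCriticalFugacity (5 / 8) z; let fullHex : ℝ → Set (Literature.Probability.LatticeModels.Site 2)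 := fun δ => {x | Literature.Barriers.CriticalPhenomena.HexKernel.hexagonFaces x ⊆ Λ δ}; let pole : ℝ → Sym2 Literature.Probability.LatticeModels.HexVertex → ℂ := fun δ e => ∑ᶠ x ∈ fullHex δ, r δ x * Literature.Barriers.CriticalPhenomena.HexKernel.witness x e; let pair : (Sym2 Literature.Probability.LatticeModels.HexVertex → ℂ) → Literature.Probability.LatticeModels.Site 2 → ℂ := fun G x => ∑ j : Fin 6, G (Literature.Barriers.CriticalPhenomena.HexKernel.edge x j) * (starRingEnd ℂ) (Literature.Barriers.CriticalPhenomena.HexKernel.val j); let region : ℝ → Set ℂ → Set (Sym2 Literature.Probability.LatticeModels.HexVertex) := fun δ K => {e | e ∈ Literature.Probability.RandomPlanarGeometry.SAW.hexDomainMidEdges (Λ δ) ∧ (δ : ℂ) * Literature.Probability.RandomPlanarGeometry.SAW.hexMidpoint e ∈ K}; (∀ᶠ δ : ℝ in nhdsWithin 0 (Set.Ioi 0), Literature.Probability.RandomPlanarGeometry.SAW.hexDomainSimplyConnected (Λ δ) ∧ a δ ∈ Literature.Probability.RandomPlanarGeometry.SAW.hexDomainBoundary (Λ δ) ∧ (Literature.Probability.LatticeModels.hexGraph.induce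 ((Λ δ : Finset Literature.Probability.LatticeModels.HexVertex) : Set Literature.Probability.LatticeModels.HexVertex)).Preconnected ∧ (∀ v ∈ Λ δ, (δ : ℂ) * Literature.Probability.LatticeModels.hexCenter v ∈ D.carrier)) → (∀ K : Set ℂ, IsCompact K → K ⊆ D.carrier → ∀ᶠ δ : ℝ in nhdsWithin 0 (Set.Ioi 0), ∀ v : Literature.Probability.LatticeModels.HexVertex, (δ : ℂ) * Literature.Probability.LatticeModels.hexCenter v ∈ K → v ∈ Λ δ) → Filter.Tendsto (fun δ : ℝ => (δ : ℂ) * Literature.Probability.RandomPlanarGeometry.SAW.hexMidpoint (a δ)) (nhdsWithin 0 (Set.Ioi 0)) (nhds (D.pt 0)) → (∀ᶠ δ : ℝ in nhdsWithin 0 (Set.Ioi 0), ∀ x ∈ fullHex δ, pair (fun e => F δ e - pole δ e) x = 0) → ∀ K : Set ℂ, IsCompact K → K ⊆ D.carrier → ∀ ε : ℝ, 0 < ε → ∀ᶠ δ : ℝ in nhdsWithin 0 (Set.Ioi 0), (∑ᶠ e ∈ region δ K, ‖pole δ e‖ ^ 2) ≤ ε * ∑ᶠ e ∈ region δ K, ‖F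 δ e‖ ^ 2

/-- item stmt-CriticalPhenomena-14055 · crux · rank 3 · open · by planner
why it might fail: G*_δ is fixed by F's BOUNDARY values: argument exact (Riemann BVP) but modulus = boundary SAW two-point function with Kennedy–Lawler lattice factors; strong L² convergence with no staggered dz̄-part is boundary conformal covariance, open; CS theory gives only precompactness; free collar off a, b.
sources: arXiv:0810.2188, ChelkakSmirnov2012Ising, KennedyLawler2013, DuminilCopinSmirnov2012, BeatonGuttmannJensen2012, arXiv:1109.3091
[crux] repaired HarmonicPartLimit [H] (replaces stmt-CriticalPhenomena-5422 in this route; same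
repair as the target): in the setting of the repaired target HexObservableLimitR (flat horizontal
boundary with the domain above and EXACT row half-lattice in a ρ-ball around BOTH marked points,
rows ≥ m i δ in ball(pt i, ρ), i = 0, 1 — Fin 2-indexed as in the shared target
stmt-CriticalPhenomena-14003; b_δ → b, a_δ → a boundary mid-edges) there is one c ≠ 0 such that the
fully discrete-holomorphic part G*_δ = F_δ − P_δ (P_δ = Σ_(full x) r_δ(x)·HexKernel.witness x, r_δ
any residue potential: ⟨F_δ − P_δ, witness x⟩ = 0 for every full hexagon x), normalised by F_δ(b_δ),
converges to c·exp((5/8)(L − L_b)) STRONGLY in L² on compacts: δ² Σ_(e∈K) |G*_δ(e)/F_δ(b_δ) − c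
e^((5/8)(L(δe) − L_b))|² → 0 (no staggered dz̄-component, constant identified) — a discrete
Riemann–Hilbert/Neumann problem of Ising type for a DETERMINED function, Chelkak–Smirnov toolbox.
What changed vs 5422: flatness of D and exactness of Λ_δ are required in the ρ-balls at BOTH marked
points (m : Fin 2 → ℝ → ℤ), exactly the hypothesis block of HexObservableLimitR plus the residue
hypothesis; 5422 as typed shares the refuted t -/
@[route_item "route-CriticalPhenomena-SAWResidueField", crux]
def HarmonicPartLimitR : Prop :=
  ∃ c : ℂ, c ≠ 0 ∧ ∀ (D : Literature.Probability.RandomPlanarGeometry.DobrushinDomain) (ρ : ℝ) (Λ : ℝ → Finset Literature.Probability.LatticeModels.HexVertex) (m : Fin 2 → ℝ → ℤ) (a b : ℝ → Sym2 Literature.Probability.LatticeModels.HexVertex) (Φ : Literature.Probability.RandomPlanarGeometry.ConformalEquiv D.carrier UpperHalfPlane.upperHalfPlaneSet) (L : ℂ → ℂ) (Lb : ℂ) (r : ℝ → Literature.Probability.LatticeModels.Site 2 → ℂ), let F : ℝ → Sym2 Literature.Probability.LatticeModels.HexVertex → ℂ := fun δ z => Literature.Probability.RandomPlanarGeometry.SAW.hexParafermionicObservable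 (Λ δ) (a δ) Literature.Probability.RandomPlanarGeometry.SAW.hexCriticalFugacity (5 / 8) z; let fullHex : ℝ → Set (Literature.Probability.LatticeModels.Site 2) := fun δ => {x | Literature.Barriers.CriticalPhenomena.HexKernel.hexagonFaces x ⊆ Λ δ}; let pole : ℝ → Sym2 Literature.Probability.LatticeModels.HexVertex → ℂ := fun δ e => ∑ᶠ x ∈ fullHex δ, r δ x * Literature.Barriers.CriticalPhenomena.HexKernel.witness x e; let pair : (Sym2 Literature.Probability.LatticeModels.HexVertex → ℂ) → Literature.Probability.LatticeModels.Site 2 → ℂ := fun G x => ∑ j : Fin 6, G (Literature.Barriers.CriticalPhenomena.HexKernel.edge x j) * (starRingEnd ℂ) (Literature.Barriers.CriticalPhenomena.HexKernel.val j); let region : ℝ → Set ℂ → Set (Sym2 Literature.Probability.LatticeModels.HexVertex) := fun δ K => {e | e ∈ Literature.Probability.RandomPlanarGeometry.SAW.hexDomainMidEdges (Λ δ) ∧ (δ : ℂ) * Literature.Probability.RandomPlanarGeometry.SAW.hexMidpoint e ∈ K}; 0 < ρ → (∀ i : Fin 2, D.carrier ∩ Metric.ball (D.pt i) ρ = {z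 : ℂ | (D.pt i).im < z.im} ∩ Metric.ball (D.pt i) ρ) → (∀ᶠ δ : ℝ in nhdsWithin 0 (Set.Ioi 0), Literature.Probability.RandomPlanarGeometry.SAW.hexDomainSimplyConnected (Λ δ) ∧ a δ ∈ Literature.Probability.RandomPlanarGeometry.SAW.hexDomainBoundary (Λ δ) ∧ b δ ∈ Literature.Probability.RandomPlanarGeometry.SAW.hexDomainBoundary (Λ δ) ∧ Nonempty (Literature.Probability.RandomPlanarGeometry.SAW.HexMidEdgeSAW (Λ δ) (a δ) (b δ)) ∧ (Literature.Probability.LatticeModels.hexGraph.induce ((Λ δ : Finset Literature.Probability.LatticeModels.HexVertex) : Set Literature.Probability.LatticeModels.HexVertex)).Preconnected ∧ (∀ v ∈ Λ δ, (δ : ℂ) * Literature.Probability.LatticeModels.hexCenter v ∈ D.carrier) ∧ (∀ i : Fin 2, ∀ v : Literature.Probability.LatticeModels.HexVertex, (δ : ℂ) * Literature.Probability.LatticeModels.hexCenter v ∈ Metric.ball (D.pt i) ρ → (v ∈ Λ δ ↔ m i δ ≤ v.1 1))) → (∀ K : Set ℂ, IsCompact K → K ⊆ D.carrier → ∀ᶠ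 δ : ℝ in nhdsWithin 0 (Set.Ioi 0), ∀ v : Literature.Probability.LatticeModels.HexVertex, (δ : ℂ) * Literature.Probability.LatticeModels.hexCenter v ∈ K → v ∈ Λ δ) → Filter.Tendsto (fun δ : ℝ => (δ : ℂ) * Literature.Probability.RandomPlanarGeometry.SAW.hexMidpoint (a δ)) (nhdsWithin 0 (Set.Ioi 0)) (nhds (D.pt 0)) → Filter.Tendsto (fun δ : ℝ => (δ : ℂ) * Literature.Probability.RandomPlanarGeometry.SAW.hexMidpoint (b δ)) (nhdsWithin 0 (Set.Ioi 0)) (nhds (D.pt 1)) → Filter.Tendsto (fun x => ‖Φ x‖) (nhdsWithin (D.pt 0) D.carrier) Filter.atTop → Φ.HasBoundaryValue (D.pt 1) 0 → ContinuousOn L D.carrier → (∀ z ∈ D.carrier, Complex.exp (L z) = deriv Φ z) → Filter.Tendsto L (nhdsWithin (D.pt 1) D.carrier) (nhds Lb) → (∀ᶠ δ : ℝ in nhdsWithin 0 (Set.Ioi 0), ∀ x ∈ fullHex δ, pair (fun e => F δ e - pole δ e) x = 0) → ∀ K : Set ℂ, IsCompact K → K ⊆ D.carrier → Filter.Tendsto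 (fun δ : ℝ => δ ^ 2 * ∑ᶠ e ∈ region δ K, ‖(F δ e - pole δ e) / F δ (b δ) - c * Complex.exp ((5 / 8 : ℂ) * (L ((δ : ℂ) * Literature.Probability.RandomPlanarGeometry.SAW.hexMidpoint e) - Lb))‖ ^ 2) (nhdsWithin 0 (Set.Ioi 0)) (nhds 0)

/-- item stmt-CriticalPhenomena-5423 · crux · rank 4 · open · by planner
why it might fail: No RSW/annulus-crossing technology for SAW (n = 0: no FKG; KS17 §4 covers FK, percolation, harmonic explorer, LERW; G2 fails for UST §4.5); strongest inputs: sub-ballisticity (DCH13, arXiv:2310.17299). Eventual form avoids refuted all-δ item 0772.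
sources: KemppainenSmirnov2017, DuminilCopinHammond2013, arXiv:2310.17299, arXiv:1212.6215, Summit.CriticalPhenomena.SAWScalingLimit.Theorems.SAWParafermionTight_refuted
[crux] eventual tightness of the critical hexagonal SAW laws: for every Dobrushin domain and
hexagonal endpoint approximation (IsEmbEndpointApprox hexGraph hexCenter), the family δ ↦ hexSAWLaw
pushed to CurveClass ℂ is tight along 𝓝[>]0 (IsTightAlongMesh — NOT the refuted all-δ IsTightLaws
form of stmt-CriticalPhenomena-0772). [difficulty: open-problem] -/
@[route_item "route-CriticalPhenomena-SAWResidueField", crux]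
def HexTight : Prop :=
  ∀ (D : Literature.Probability.RandomPlanarGeometry.DobrushinDomain) (a b : ℝ → Literature.Probability.LatticeModels.HexVertex), Literature.Probability.RandomPlanarGeometry.SAW.IsEmbEndpointApprox Literature.Probability.LatticeModels.hexGraph Literature.Probability.LatticeModels.hexCenter D a b → Literature.Probability.RandomPlanarGeometry.IsTightAlongMesh (fun δ (γ : Literature.Probability.RandomPlanarGeometry.SAW.HexDomainSAW D.carrier δ (a δ) (b δ)) => γ.curve) (fun δ => Literature.Probability.RandomPlanarGeometry.SAW.hexSAWLaw D.carrier δ (a δ) (b δ))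

/-- item stmt-CriticalPhenomena-14005 · crux · rank 5 · SPLIT (gen 1) into NestedRenewalFatCoSolidR, MacroSourceLocality, HexSimpleSubseqLimits + glue ObservableToSLERGlue · direct attempts still welcome (low priority) · by planner
why it might fail: Needs the observable limit in the SAW's own slit domains (root at the tip, rough, Carathéodory-uniform); HexObservableLimitR is per fixed Jordan domain with both marked points on flat lattice-pinned pieces (a benchmark instance); projective data fix κ = 8/3, not the drift.
sources: LawlerSchrammWerner2003, arXiv:math/0209343, KemppainenSmirnov2017, DuminilCopinSmirnov2012Clay, Smirnov2007ICM, DuminilCopinSmirnov2012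
[crux] the martingale-observable identification for the hexagonal SAW over the repaired target:
HexObservableLimitR → HexTight → (Duminil-Copin–Smirnov 2012 Conjecture 1 written out: for every
Dobrushin domain and hexagonal endpoint approximation the critical hexagonal SAW law hexSAWLaw,
pushed to CurveClass ℂ, converges in law to chordal SLE(8/3) — verbatim the definiens of Literature
HexSAWScalingLimit and of the shared item HexConjecture, stmt-CriticalPhenomena-0808); re-targeting
for this route of the shared ObservableToSLE (stmt-CriticalPhenomena-10472), which became vacuous
when its antecedent HexObservableLimit was refuted. Intended proof unchanged: the b-normalised
observable ⟨ψ, F_(Ω∖γ[0,n])⟩/F_(Ω∖γ[0,n])(b) is an exact discrete martingale (domain Markov property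
of the SAW), its limit c⟨ψ,(φ_n'/φ_n'(b))^(5/8)⟩ forces the driving process of every subsequential
limit to be √(8/3)B (LSW03 Prop. 5.2 / Itô on g_t'^(5/8)(g_t − W_t)^(−5/4)), and tightness +
uniqueness of the SLE law conclude (SLEConvergenceCriterion). Now explicit as the FIRST step:
bootstrap Conj. 2 from the flat-pinned family of HexObservableLimitR (a, b on horizontal
half-lattice pieces) to Carathéodory-conve -/
@[route_item "route-CriticalPhenomena-SAWResidueField", crux]
def ObservableToSLER : Prop :=
  HexObservableLimitR → HexTight → ∀ (D : Literature.Probability.RandomPlanarGeometry.DobrushinDomain) (a b : ℝ → Literature.Probability.LatticeModels.HexVertex), Literature.Probability.RandomPlanarGeometry.SAW.IsEmbEndpointApprox Literature.Probability.LatticeModels.hexGraph Literature.Probability.LatticeModels.hexCenter D a b → Literature.Probability.RandomPlanarGeometry.ConvergesInLawToSLE ((8 : NNReal) / 3) D (fun δ (γ : Literature.Probability.RandomPlanarGeometry.SAW.HexDomainSAW D.carrier δ (a δ) (b δ)) => γ.curve) (fun δ => Literature.Probability.RandomPlanarGeometry.SAW.hexSAWLaw D.carrier δ (a δ) (b δ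))

-- parent: ObservableToSLER · child (gen 1)
/--     item stmt-CriticalPhenomena-17698 · crux · rank 501 · open
    parent: ObservableToSLER · by planner
    why it might fail: A Jordan geometry near a mark could cage every designer family at all scales ≤ R (forced dirty exits / forced returns); abundance needs a band-wise renewal void bound uniform over pasts — quasi-independence across scales at n=0, open even in the half-plane (only B_T→0, KP26).
    sources: Kesten1963SAW, arXiv:0909.0203, arXiv:1008.4321, arXiv:1109.0358, arXiv:2310.17299, DuminilCopinSmirnov2012
[crux] (child 1/4 — the HARDEST — of the r11 residue split of ObservableToSLER, stmt-14005; =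
registered stub 2ʀ `stub_nestedRenewalFatCoSolidR` of skeleton r11 of line bridge-gate-renewal,
verbatim up to `open … in`; = hypothesis h2 of the LANDED glue
Residue.observableToSLER_of_residueSolid) NESTED RENEWAL WITH FAT CO-ORIENTED SOLID TAME FAMILIES,
LOCALITY SCALE BOUNDED: for every Dobrushin domain D, endpoint approximation (a_δ, b_δ) and ε > 0
there is R₂ > 0 such that for every locality scale R ∈ (0, R₂] there are a window radius ρ > 0 and a
tameness bound N with: eventually as δ → 0⁺ there EXIST tame nested families S (about a_δ) and T
(about b_δ) of lattice level sets (TameNestedFamily δ R N), every level exterior-anchored, all clean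
ρ-windows of ONE common class j : Fin 6 (signed-row half-lattice inside the window), fat level
bodies under every clean window and fat spines (no dangling level pieces), such that the critical
hexagonal SAW law hexSAWLaw D δ a_δ b_δ gives mass ≤ ε to the walks WITHOUT a widely linked pair of
FIRST GOOD GATES (first exit of S n through a clean-window edge with no return and a wide escape;
likewise for T n' from the b side; WideLink between the two -/
@[route_item "route-CriticalPhenomena-SAWResidueField"]
def NestedRenewalFatCoSolidR : Prop :=
  open Literature.Probability.LatticeModels Literature.Probability.RandomPlanarGeometry Literature.Probability.RandomPlanarGeometry.SAW UpperHalfPlane Metric Summit.CriticalPhenomena.SAWScalingLimit.Theorems.ObservableToSLER.BridgeGate Summit.CriticalPhenomena.SAWScalingLimit.Theorems.ObservableToSLER.NestedGate in ∀ (D : DobrushinDomain) (a b : ℝ → HexVertex), IsEmbEndpointApprox hexGraph hexCenter D a b → ∀ ε > (0 : ℝ), ∃ R₂ > (0 : ℝ), ∀ R ∈ Set.Ioc (0 : ℝ) R₂, ∃ ρ > (0 : ℝ), ∃ N : ℕ, ∀ᶠ δ : ℝ in 𝓝[>] 0, ∃ S T : ℕ → Set HexVertex, TameNestedFamily δ R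 N (a δ) S ∧ TameNestedFamily δ R N (b δ) T ∧ ((∀ n, ExteriorAnchored D.carrier δ (S n) (a δ)) ∧ (∀ n, ExteriorAnchored D.carrier δ (T n) (b δ)) ∧ ∃ j : Fin 6, ((∀ (n : ℕ) (p q : HexVertex), HasCleanWindow D.carrier δ ρ (S n) p q → rowOf j q = rowOf j p + 1 ∧ ∀ x : HexVertex, (δ : ℂ) * hexCenter x ∈ ball ((δ : ℂ) * hexCenter q) ρ → (x ∈ S n ↔ rowOf j x ≤ rowOf j p)) ∧ (∀ (n : ℕ) (p q : HexVertex), HasCleanWindow D.carrier δ ρ (T n) p q → rowOf j q = rowOf j p + 1 ∧ ∀ x : HexVertex, (δ : ℂ) * hexCenter x ∈ ball ((δ : ℂ) * hexCenter q) ρ → (x ∈ T n ↔ rowOf j x ≤ rowOf j p))) ∧ (∀ (n : ℕ) (p q : HexVertex), HasCleanWindow D.carrier δ ρ (S n) p q → ∃ K : Set ℂ, IsCompact K ∧ IsConnected K ∧ (δ : ℂ) * hexCenter q - ((ρ / 2 : ℝ) : ℂ) * Complex.I * triZeta ^ (j : ℕ) ∈ K ∧ (δ : ℂ) * hexCenter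 (a δ) ∈ K ∧ ∀ v : HexVertex, Metric.infDist ((δ : ℂ) * hexCenter v) K ≤ ρ / 4 → v ∈ S n) ∧ (∀ (n : ℕ) (p q : HexVertex), HasCleanWindow D.carrier δ ρ (T n) p q → ∃ K : Set ℂ, IsCompact K ∧ IsConnected K ∧ (δ : ℂ) * hexCenter q - ((ρ / 2 : ℝ) : ℂ) * Complex.I * triZeta ^ (j : ℕ) ∈ K ∧ (δ : ℂ) * hexCenter (b δ) ∈ K ∧ ∀ v : HexVertex, Metric.infDist ((δ : ℂ) * hexCenter v) K ≤ ρ / 4 → v ∈ T n) ∧ (∀ n : ℕ, ∃ K : Set ℂ, IsCompact K ∧ IsConnected K ∧ (δ : ℂ) * hexCenter (a δ) ∈ K ∧ (∀ v : HexVertex, Metric.infDist ((δ : ℂ) * hexCenter v) K ≤ ρ / 8 → v ∈ S n) ∧ (∀ v ∈ S n, ∃ (t w : HexVertex) (r : ℕ), v ∈ hexBall t r ∧ w ∈ hexBall t r ∧ hexBall t r ⊆ S n ∧ Metric.infDist ((δ : ℂ) * hexCenter w) K ≤ ρ / 16)) ∧ (∀ n : ℕ, ∃ K : Set ℂ, IsCompact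 K ∧ IsConnected K ∧ (δ : ℂ) * hexCenter (b δ) ∈ K ∧ (∀ v : HexVertex, Metric.infDist ((δ : ℂ) * hexCenter v) K ≤ ρ / 8 → v ∈ T n) ∧ (∀ v ∈ T n, ∃ (t w : HexVertex) (r : ℕ), v ∈ hexBall t r ∧ w ∈ hexBall t r ∧ hexBall t r ⊆ T n ∧ Metric.infDist ((δ : ℂ) * hexCenter w) K ≤ ρ / 16))) ∧ hexSAWLaw D.carrier δ (a δ) (b δ) {γ | ¬ ∃ (n m : ℕ) (p q : HexVertex) (n' m' : ℕ) (p' q' : HexVertex), IsFirstGoodGateN D.carrier δ ρ R S (a δ) γ.walk.support n m p q ∧ IsFirstGoodGateN D.carrier δ ρ R T (b δ) γ.walk.support.reverse n' m' p' q' ∧ WideLink D.carrier δ ρ (S n ∪ T n') q q'} ≤ ENNReal.ofReal ε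

-- parent: ObservableToSLER · child (gen 1)
/--     item stmt-CriticalPhenomena-17955 · crux · rank 502 · open
    parent: ObservableToSLER · by planner
    why it might fail: Fails only with a source-side mass deficit: chords a→s carrying a fixed fraction of x_c-mass on macroscopic excursions as s→a; excluded by the conjectured boundary scaling limit (exponent 5/4), but no lattice bound controls the conditioned far mass (cut-point sums diverge).
    sources: DuminilCopinSmirnov2012, arXiv:math/0204277, arXiv:1109.0358, LawlerSchrammWerner2003
[crux] MACROSCOPIC SOURCE LOCALITY — the weakened anchor of the live line (six-class-type-ladder r11
/ twin bridge-gate-renewal r13–r14; verbatim the registered stub `stub_macroSourceLocality` and the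
second hypothesis of the landed consumer `ObservableToSLER.Macro.stub_macroRestrictionLimit`): for a
Dobrushin domain E flat (exact upper half-lattice) in the ball B(pt 0, ρ), every admissible family
Λ_δ (simply connected, connected, inside E, exact half-lattice in the ball, exhausting compacts)
with source a_δ → pt 0, every ε > 0 and every FIXED radius r > 0 there is t₀ > 0 such that for floor
targets s_δ → pt 0 + t with 0 < |t| < t₀, eventually along δ → 0⁺ the x_c-mass of the chords a_δ →
s_δ reaching scaled distance ≥ r from the source is ≤ ε · (total x_c-mass of the chords). Strictly
weaker than the K-uniform TwoPieceSourceLocality (stmt-CriticalPhenomena-17689;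
`macroSourceLocality_of_twoPieceSourceLocality`, landed) and sufficient for the two-piece admissible
restriction limit; the only anchor the identification consumes. Why it might fail: Fails only with a
source-side mass deficit L_A < 1: merging-endpoint chords carrying a fixed fraction of x_c-mass on
macroscopic excursions -/
@[route_item "route-CriticalPhenomena-SAWResidueField"]
def MacroSourceLocality : Prop :=
  ∀ (E : Literature.Probability.RandomPlanarGeometry.DobrushinDomain) (ρ : ℝ) (Λ : ℝ → Finset Literature.Probability.LatticeModels.HexVertex) (m₀ : ℝ → ℤ) (a : ℝ → Sym2 Literature.Probability.LatticeModels.HexVertex), 0 < ρ → E.carrier ∩ Metric.ball (E.pt 0) ρ = {z : ℂ | (E.pt 0).im < z.im} ∩ Metric.ball (E.pt 0) ρ → (∀ᶠ δ : ℝ in nhdsWithin 0 (Set.Ioi 0), Literature.Probability.RandomPlanarGeometry.SAW.hexDomainSimplyConnected (Λ δ) ∧ (Literature.Probability.LatticeModels.hexGraph.induce ((Λ δ : Finset Literature.Probability.LatticeModels.HexVertex) : Set Literature.Probability.LatticeModels.HexVertex)).Preconnected ∧ a δ ∈ Literature.Probability.RandomPlanarGeometry.SAW.hexDomainBoundary (Λ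 δ) ∧ (∀ v ∈ Λ δ, (δ : ℂ) * Literature.Probability.LatticeModels.hexCenter v ∈ E.carrier) ∧ (∀ v : Literature.Probability.LatticeModels.HexVertex, (δ : ℂ) * Literature.Probability.LatticeModels.hexCenter v ∈ Metric.ball (E.pt 0) ρ → (v ∈ Λ δ ↔ m₀ δ ≤ v.1 1))) → (∀ K : Set ℂ, IsCompact K → K ⊆ E.carrier → ∀ᶠ δ : ℝ in nhdsWithin 0 (Set.Ioi 0), ∀ v : Literature.Probability.LatticeModels.HexVertex, (δ : ℂ) * Literature.Probability.LatticeModels.hexCenter v ∈ K → v ∈ Λ δ) → Filter.Tendsto (fun δ : ℝ => (δ : ℂ) * Literature.Probability.RandomPlanarGeometry.SAW.hexMidpoint (a δ)) (nhdsWithin 0 (Set.Ioi 0)) (nhds (E.pt 0)) → ∀ ε : ℝ, 0 < ε → ∀ r : ℝ, 0 < r → ∃ t₀ : ℝ, 0 < t₀ ∧ ∀ (s : ℝ → Sym2 Literature.Probability.LatticeModels.HexVertex) (t : ℝ), t ≠ 0 → |t| < t₀ → (∀ᶠ δ : ℝ in nhdsWithin 0 (Set.Ioi 0), s δ ∈ Literature.Probability.RandomPlanarGeometry.SAW.hexDomainBoundary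 (Λ δ) ∧ (Literature.Probability.RandomPlanarGeometry.SAW.hexMidpoint (s δ)).im = (Literature.Probability.RandomPlanarGeometry.SAW.hexMidpoint (a δ)).im) → Filter.Tendsto (fun δ : ℝ => (δ : ℂ) * Literature.Probability.RandomPlanarGeometry.SAW.hexMidpoint (s δ)) (nhdsWithin 0 (Set.Ioi 0)) (nhds (E.pt 0 + t)) → ∀ᶠ δ : ℝ in nhdsWithin 0 (Set.Ioi 0), (∑ γ : Literature.Probability.RandomPlanarGeometry.SAW.HexMidEdgeSAW (Λ δ) (a δ) (s δ), if ∃ v ∈ γ.verts, r ≤ dist ((δ : ℂ) * Literature.Probability.LatticeModels.hexCenter v) ((δ : ℂ) * Literature.Probability.RandomPlanarGeometry.SAW.hexMidpoint (a δ)) then Literature.Probability.RandomPlanarGeometry.SAW.hexCriticalFugacity ^ γ.length else 0) ≤ ε * ∑ γ : Literature.Probability.RandomPlanarGeometry.SAW.HexMidEdgeSAW (Λ δ) (a δ) (s δ), Literature.Probability.RandomPlanarGeometry.SAW.hexCriticalFugacity ^ γ.length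

-- parent: ObservableToSLER · child (gen 1)
/--     item stmt-CriticalPhenomena-7148 · crux · rank 503 · open
    parent: ObservableToSLER · by planner
    why it might fail: A subsequential limit of critical hexagonal SAW could retrace a sub-arc (vanishing-width hairpins) or crawl along ∂D; at n=0 only sub-ballisticity (DCH13, KP26) is known — no near-self-approach or boundary-crawl estimate in print.
    sources: arXiv:math/0209343, DuminilCopinHammond2013, arXiv:2310.17299, KemppainenSmirnov2017
[support] (S_H) for every Dobrushin domain, hexagonal endpoint approximation, sequence s_n → 0+ and
probability measure ν on CurveClass ℂ that is the weak limit of the pushed-forward hexagonal SAW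
laws along s_n, ν-a.e. curve class is simple, runs from a = D.pt 0 to b = D.pt 1, has range in
closure D and meets ∂D only at a, b (the carrier clause of AvoidanceDeterminesLaw). Hex twin of
SAWLoopFugacityFlow.SimpleSubseqLimits (stmt-CriticalPhenomena-4982). Load-bearing and believed open
(no-retracing / no-boundary-crawling bounds at x_c are not in print, only sub-ballisticity); filed
as support because value-free and not specific to this line; foreseen inputs: HexRestrictionLaw +
filled-range Lemma 3.2 + SLE_(8/3) simplicity for the 'simple boundary-avoiding range' half, a
near-self-approach estimate (ConformalTowers' 2-leg weight h_(3,1) = 2 is the CFT reason) for 'no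
retracing'. [difficulty: open-problem] -/
@[route_item "route-CriticalPhenomena-SAWResidueField"]
def HexSimpleSubseqLimits : Prop :=
  ∀ (D : Literature.Probability.RandomPlanarGeometry.DobrushinDomain) (a b : ℝ → Literature.Probability.LatticeModels.HexVertex), Literature.Probability.RandomPlanarGeometry.SAW.IsEmbEndpointApprox Literature.Probability.LatticeModels.hexGraph Literature.Probability.LatticeModels.hexCenter D a b → ∀ (s : ℕ → ℝ) (ν : MeasureTheory.Measure (Literature.Probability.RandomPlanarGeometry.CurveClass ℂ)), Filter.Tendsto s Filter.atTop (nhdsWithin 0 (Set.Ioi 0)) → MeasureTheory.IsProbabilityMeasure ν → (∀ f : BoundedContinuousFunction (Literature.Probability.RandomPlanarGeometry.CurveClass ℂ) ℝ, Filter.Tendsto (fun n => ∫ γ, f γ.curve ∂(Literature.Probability.RandomPlanarGeometry.SAW.hexSAWLaw D.carrier (s n) (a (s n)) (b (s n)))) Filter.atTop (nhds (∫ x, f x ∂ν))) → ∀ᵐ γ ∂ν, γ ∈ Literature.Probability.RandomPlanarGeometry.CurveClass.simple ∧ γ.source = D.pt 0 ∧ γ.target = D.pt 1 ∧ γ.range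 ⊆ closure D.carrier ∧ γ.range ∩ frontier D.carrier ⊆ {D.pt 0, D.pt 1}

-- parent: ObservableToSLER · glue (gen 1)
/--     item stmt-CriticalPhenomena-18179 · support · rank 504 · open
    parent: ObservableToSLER · GLUE: children ⟹ parent · by operator
PROVED GLUE (to be landed by any prover; Theorems/ is prover-only): NestedRenewalFatCoSolidR →
MacroSourceLocality → HexSimpleSubseqLimits → ObservableToSLER is the strategist certificate
`ResidueFieldSplit.ObservableToSLER_of_subs` (file SAWResidueFieldObservableToSLERSplit.lean, lean
check rc0, 0 sorry, axioms propext/Classical.choice/Quot.sound; evidence on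
stmt-CriticalPhenomena-14005, 2026-08-17 s5) = Residue.observableToSLER_of_residueMacro (p148257)
with its squeeze hypothesis 5a4″ discharged by the landed T-A
TypeLadder.carvedReduction_squeezeGeometry + T-B stub_carvedReduction_ratioSqueeze (p131716), and
the Iff.rfl identity of the route copies. -/
@[route_item "route-CriticalPhenomena-SAWResidueField"]
def ObservableToSLERGlue : Prop :=
  NestedRenewalFatCoSolidR → MacroSourceLocality → HexSimpleSubseqLimits → ObservableToSLER

/-- item stmt-CriticalPhenomena-0807 · crux · rank 6 · open · by planner
why it might fail: Uniform Z² SAW is in no Yang–Baxter/integrable family (GM19 p.1; barrier NienhuisWeightsExcludeVertexSAW): no transfer tool reaches it; lattice effects persist in limits of boundary SAW ensembles (KennedyLawler2013); typed 'P^Z2 − P^Hex → 0' needs tightness of both, open.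
sources: GlazmanManolescu2019, KennedyLawler2013, DuminilCopinSmirnov2012, Literature.Barriers.CriticalPhenomena.NienhuisWeightsExcludeVertexSAW, Literature.Barriers.CriticalPhenomena.not_hasExactVertexRelationZ2
[crux] r2 (hardest, most informative; informal until defn HexSAWLaw lands): lattice universality of
the chordal critical SAW law — for every Dobrushin domain (Ω; a, b), every square-lattice endpoint
approximation (a_δ, b_δ) (Literature.Probability.RandomPlanarGeometry.SAW.IsEndpointApprox) and
every hexagonal-lattice endpoint approximation (a'_δ, b'_δ), and every bounded continuous f on
CurveClass ℂ: ∫ f∘curve dP^{Z^2}_{x_c(Z^2),δ} − ∫ f∘curve dP^{Hex}_{x_c(Hex),δ} → 0 as δ → 0+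
(x_c(Hex) = 1/√(2+√2), Duminil-Copin–Smirnov 2012 Thm 1). Tool: Yang–Baxter track exchange on
rhombic tilings (Glazman–Manolescu arXiv:1708.00395 §3), which so far controls boundary two-point
functions, not curve laws. -/
@[route_item "route-CriticalPhenomena-SAWResidueField", crux]
def LatticeUniversality : Prop :=
  ∀ (D : Literature.Probability.RandomPlanarGeometry.DobrushinDomain) (a b : ℝ → Literature.Probability.LatticeModels.Site 2) (a' b' : ℝ → Literature.Probability.LatticeModels.HexVertex), Literature.Probability.RandomPlanarGeometry.SAW.IsEndpointApprox D a b → Literature.Probability.RandomPlanarGeometry.SAW.IsEmbEndpointApprox Literature.Probability.LatticeModels.hexGraph Literature.Probability.LatticeModels.hexCenter D a' b' → ∀ f : BoundedContinuousFunction (Literature.Probability.RandomPlanarGeometry.CurveClass ℂ) ℝ, Filter.Tendsto (fun δ => (∫ γ, f γ.curve ∂(Literature.Probability.RandomPlanarGeometry.SAW.law D.carrier δ (a δ) (b δ))) - ∫ γ, f γ.curve ∂(Literature.Probability.RandomPlanarGeometry.SAW.hexSAWLaw D.carrier δ (a' δ) (b' δ))) (nhdsWithin 0 (Set.Ioi 0))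 (nhds 0)

-- earlier SynthesisR (stmt-CriticalPhenomena-14056, replaced 2026-08-16T00:13:43Z -> stmt-CriticalPhenomena-14066): retired by None — ResidueExists ∧ ResidueEnergyVanishes ∧ HarmonicPartLimitR → HexObservableLimitR
/-- item stmt-CriticalPhenomena-14066 · support · rank 9 · open · by planner
sources: arXiv:0810.2188, DuminilCopinSmirnov2012
[support] glue of layer 1 over the repaired items: ResidueEnergyVanishes → HarmonicPartLimitR →
HexObservableLimitR (rev-8 form: the residue-selection hypothesis is no longer an antecedent — the
prover obtains a residue potential r_δ for G = F_δ from the support ResidueExists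
(stmt-CriticalPhenomena-5425, provable-now linear algebra; cite its _holds theorem or re-prove it as
a --supports helper), so that this decl only mentions items rendered above it). Proof sketch: for an
instance of the repaired target pick r_δ, apply [R] to (D, Λ, a, r) (its hypothesis block is a
sub-block of the target's) and [H]R to the full instance; Cauchy–Schwarz |δ²Σψ(F − G*)| ≤
(δ²Σ|ψ|²)^(1/2)(δ²Σ_K|P|²)^(1/2) with K = tsupport ψ, δ²Σ_K|P|² ≤ 2ε/(1−2ε)·δ²Σ_K|G*|² bounded by
[H]R; edge-density Riemann sums δ²Σ_e g(δ·mid e) → 2√3 ∫ g turn the strong L² limit of G*/F(b_δ)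
into the weak limit with constant 2√3·c. Pure analysis (M). Sources: arXiv:0810.2188,
DuminilCopinSmirnov2012. -/
@[route_item "route-CriticalPhenomena-SAWResidueField", crux]
def SynthesisR : Prop :=
  ResidueEnergyVanishes → HarmonicPartLimitR → HexObservableLimitR

/-- item stmt-CriticalPhenomena-14521 · support · rank 9 · closed · proved by Summit.CriticalPhenomena.SAWScalingLimit.Cruxes.HexTransfer.Sandwich.squareTransfer @ f271614a0874 (prover) · by planner
sources: DuminilCopinSmirnov2012, GlazmanManolescu2019, Literature.Probability.RandomPlanarGeometry.SAW.aemeasurable_curve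
[support] the δℤ² transfer, glue of layer 2 (bookkeeping; replaces HexToSquare,
stmt-CriticalPhenomena-10473, in this route from rev 9 — that item stays with its four sibling
routes): [HexEndpointApproxExists, written out so that the two new supports do not reference each
other] → [critical hexagonal SAW ⇒ chordal SLE(8/3) for every Dobrushin domain and every hexagonal
endpoint approximation, WRITTEN OUT — verbatim the conclusion of the crux ObservableToSLE] →
LatticeUniversality → SAWScalingLimit. Proof (routine): fix a Dobrushin domain D and a δℤ² endpoint
approximation (a, b) (IsEndpointApprox); HexEndpointApproxExists gives a hexagonal (a′, b′); the
written-out hexagonal limit at (D, a′, b′) yields an SLE(8/3) random curve Γ with TendstoLaw of the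
hexSAWLaw-curves; take the same Γ for the δℤ² laws: AEMeasurable from the discrete σ-algebra
(SAW.aemeasurable_curve), and for each bounded continuous f write ∫ f∘curve dP^{ℤ²}_δ = (∫ f∘curve
dP^{ℤ²}_δ − ∫ f∘curve dP^{Hex}_δ) + ∫ f∘curve dP^{Hex}_δ → 0 + E f(Γ) by LatticeUniversality at (D,
a, b, a′, b′) and Tendsto.add; repack ConvergesInLawToSLE. In `closes` the bracketed antecedent is
supplied as ObservableToSLE (QCIdentification h -/
@[route_item "route-CriticalPhenomena-SAWResidueField", crux]
def SquareTransfer : Prop :=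
  (∀ (D : Literature.Probability.RandomPlanarGeometry.DobrushinDomain) (a b : ℝ → Literature.Probability.LatticeModels.Site 2), Literature.Probability.RandomPlanarGeometry.SAW.IsEndpointApprox D a b → ∃ a' b' : ℝ → Literature.Probability.LatticeModels.HexVertex, Literature.Probability.RandomPlanarGeometry.SAW.IsEmbEndpointApprox Literature.Probability.LatticeModels.hexGraph Literature.Probability.LatticeModels.hexCenter D a' b') → (∀ (D : Literature.Probability.RandomPlanarGeometry.DobrushinDomain) (a b : ℝ → Literature.Probability.LatticeModels.HexVertex), Literature.Probability.RandomPlanarGeometry.SAW.IsEmbEndpointApprox Literature.Probability.LatticeModels.hexGraph Literature.Probability.LatticeModels.hexCenter D a b → Literature.Probability.RandomPlanarGeometry.ConvergesInLawToSLE ((8 : NNReal) / 3) D (fun δ (γ : Literature.Probability.RandomPlanarGeometry.SAW.HexDomainSAW D.carrier δ (a δ) (b δ)) => γ.curve) (fun δ => Literature.Probability.RandomPlanarGeometry.SAW.hexSAWLaw D.carrier δ (a δ) (b δ))) → LatticeUniversality → SAWScalingLimit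

-- `SquareTransfer` holds: proved by `Summit.CriticalPhenomena.SAWScalingLimit.Cruxes.HexTransfer.Sandwich.squareTransfer` @ f271614a0874 (its module imports this route file, so no `_holds` link can be stated here).

/-- item stmt-CriticalPhenomena-5425 · support · rank 9 · open · by planner
sources: Literature.Barriers.CriticalPhenomena.ParafermionicHalfCauchyRiemann, arXiv:0810.2188
[support] linear algebra: for every finite vertex set Λ and every function G on mid-edges there is a
residue potential r (orthogonality of G − Σ_(full x) r(x)·witness x to every face pole of a full
hexagon) — equivalently the face poles HexKernel.witness x of distinct hexagons are linearly
independent (peel an extremal hexagon); gives existence (and, with the same argument, uniqueness) of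
the splitting F = G* + P and Pythagoras. [difficulty: provable-now] -/
@[route_item "route-CriticalPhenomena-SAWResidueField"]
def ResidueExists : Prop :=
  ∀ (Λ : Finset Literature.Probability.LatticeModels.HexVertex) (G : Sym2 Literature.Probability.LatticeModels.HexVertex → ℂ), ∃ r : Literature.Probability.LatticeModels.Site 2 → ℂ, ∀ x : Literature.Probability.LatticeModels.Site 2, Literature.Barriers.CriticalPhenomena.HexKernel.hexagonFaces x ⊆ Λ → ∑ j : Fin 6, (G (Literature.Barriers.CriticalPhenomena.HexKernel.edge x j) - ∑ᶠ y ∈ {y : Literature.Probability.LatticeModels.Site 2 | Literature.Barriers.CriticalPhenomena.HexKernel.hexagonFaces y ⊆ Λ}, r y * Literature.Barriers.CriticalPhenomena.HexKernel.witness y (Literature.Barriers.CriticalPhenomena.HexKernel.edge x j)) * (starRingEnd ℂ) (Literature.Barriers.CriticalPhenomena.HexKernel.val j) = 0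

/-- item stmt-CriticalPhenomena-5426 · support · rank 9 · open · by planner
sources: Literature.Barriers.CriticalPhenomena.ParafermionicHalfCauchyRiemann, DuminilCopinSmirnov2012, arXiv:math-ph/0111043
[support] the barrier's kernel identified (card item r5): for a simply connected hexagonal domain Λ
(connected complement), every function satisfying all DCS vertex relations on Λ, supported on the
domain's mid-edges and vanishing on the boundary mid-edges, is a linear combination of the face
poles HexKernel.witness x of the FULL hexagons of Λ (flow picture: kernel = cycle space Z₁ of the
plane graph (Λ, interior edges), whose bounded faces are single hexagons because the complement is
connected; face cycles span Z₁). [difficulty: M] -/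
@[route_item "route-CriticalPhenomena-SAWResidueField"]
def KernelIsFacePoles : Prop :=
  ∀ (Λ : Finset Literature.Probability.LatticeModels.HexVertex) (G : Sym2 Literature.Probability.LatticeModels.HexVertex → ℂ), Literature.Probability.RandomPlanarGeometry.SAW.hexDomainSimplyConnected Λ → Literature.Barriers.CriticalPhenomena.SatisfiesVertexRelations Λ G → (∀ e, e ∉ Literature.Probability.RandomPlanarGeometry.SAW.hexDomainMidEdges Λ → G e = 0) → (∀ e ∈ Literature.Probability.RandomPlanarGeometry.SAW.hexDomainBoundary Λ, G e = 0) → ∃ r : Literature.Probability.LatticeModels.Site 2 → ℂ, ∀ e, G e = ∑ᶠ x ∈ {x : Literature.Probability.LatticeModels.Site 2 | Literature.Barriers.CriticalPhenomena.HexKernel.hexagonFaces x ⊆ Λ}, r x * Literature.Barriers.CriticalPhenomena.HexKernel.witness x e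

/-- item stmt-CriticalPhenomena-9864 · support · rank 9 · closed · proved by Summit.CriticalPhenomena.SAWScalingLimit.Theorems.HexEndpointApprox.hexEndpointApproxExists @ 109199b0e098 (prover) · by planner
sources: DuminilCopinSmirnov2012, LawlerSchrammWerner2004SAW, Literature.Probability.RandomPlanarGeometry.SAW.exists_isEndpointApprox
[support] every Dobrushin domain that admits a δℤ² endpoint approximation admits a hexagonal one:
IsEndpointApprox D a b → ∃ a′ b′ : ℝ → HexVertex, IsEmbEndpointApprox hexGraph hexCenter D a′ b′.
Proof route: for a bounded Jordan domain the bulk connected component of the hexagonal mesh graph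
(the one containing the cells of any fixed compact K ⊂ Ω once δ is small) is the unique largest
component for small δ (every other component lies in the part of Ω not δ-path-connected to K, whose
cell count is o(δ⁻²)), and it accumulates at every boundary point (Ω open and connected: interior
points near D.pt 0, D.pt 1 are joined to K by compact paths at positive distance from ∂Ω); choose
a′_δ, b′_δ in it with δ·hexCenter → the marked points. The discretisation geometry hidden in every
Hex → ℤ² transfer (implicit in the shared glue stmt-CriticalPhenomena-5428); natural Literature
home: a lemma exists_isEmbEndpointApprox in HexSAW.lean. [difficulty: M] [sources:
DuminilCopinSmirnov2012 §4; LawlerSchrammWerner2004SAW §3.4] -/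
@[route_item "route-CriticalPhenomena-SAWResidueField", crux]
def HexEndpointApproxExists : Prop :=
  ∀ (D : Literature.Probability.RandomPlanarGeometry.DobrushinDomain) (a b : ℝ → Literature.Probability.LatticeModels.Site 2), Literature.Probability.RandomPlanarGeometry.SAW.IsEndpointApprox D a b → ∃ a' b' : ℝ → Literature.Probability.LatticeModels.HexVertex, Literature.Probability.RandomPlanarGeometry.SAW.IsEmbEndpointApprox Literature.Probability.LatticeModels.hexGraph Literature.Probability.LatticeModels.hexCenter D a' b'

/-- `HexEndpointApproxExists` holds: proved by `Summit.CriticalPhenomena.SAWScalingLimit.Theorems.HexEndpointApprox.hexEndpointApproxExists` @ 109199b0e098. -/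
theorem HexEndpointApproxExists_holds : HexEndpointApproxExists := _root_.Summit.CriticalPhenomena.SAWScalingLimit.Theorems.HexEndpointApprox.hexEndpointApproxExists

-- earlier Assembly (stmt-CriticalPhenomena-14067, replaced 2026-08-16T00:16:05Z -> stmt-CriticalPhenomena-14084): retired by None — SynthesisR → ResidueEnergyVanishes → HarmonicPartLimitR → HexTight → ObservableToSLER → HexToSquare → LatticeUniversality → SAWScalingLimit
-- earlier Assembly (stmt-CriticalPhenomena-5429, replaced 2026-08-16T00:14:18Z -> stmt-CriticalPhenomena-14067): retired by None — ResidueExists → Synthesis → ResidueEnergyVanishes → HarmonicPartLimit → HexTight → ObservableToSLE → HexToSquare → LatticeUniversality → SAWScalingLimit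
/-- item stmt-CriticalPhenomena-14084 · assembly · rank 1 · open · by planner
sources: DuminilCopinSmirnov2012, KemppainenSmirnov2017, GlazmanManolescu2019
[assembly] the route in one statement, glue folded in (rev-10 ground repair: the pure-logic chain
through the glue supports SynthesisR / HexToSquare is `closes` itself and was flagged ground.trivial
as an ITEM): the two layer-1 cruxes [R] ResidueEnergyVanishes and [H]R HarmonicPartLimitR, eventual
tightness HexTight, the martingale identification ObservableToSLER and LatticeUniversality imply
SAWScalingLimit. Proof = SynthesisR (layer-1 glue: residue selection from ResidueExists,
Cauchy–Schwarz + edge-density Riemann sums, giving HexObservableLimitR) followed by ObservableToSLER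
(→ DCS Conjecture 1 on the hexagonal lattice = HexConjecture) and the layer-2 transport HexToSquare
(choose a hexagonal endpoint approximation for the same Dobrushin domain, add the
LatticeUniversality limit on bounded continuous test functions, unpack/repack ConvergesInLawToSLE):
Assembly = fun hR hH hT hO hU => HexToSquare_holds (hO (SynthesisR_holds hR hH) hT) hU once the two
glue supports are proved. Difficulty M (the content of the two glue supports), not logic. -/
@[route_item "route-CriticalPhenomena-SAWResidueField"]
def Assembly : Prop :=
  ResidueEnergyVanishes → HarmonicPartLimitR → HexTight → ObservableToSLER → LatticeUniversality → SAWScalingLimit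

-- records of items no longer active in this route (dropped / restated):
-- earlier ObservableToSLE (stmt-CriticalPhenomena-10472, replaced 2026-08-16T00:10:46Z -> stmt-CriticalPhenomena-14005): open — HexObservableLimit → HexTight → ∀ (D : Literature.Probability.RandomPlanarGeometry.DobrushinDomain) (a b : ℝ → Literature.Probability.LatticeModels.HexVertex), Literature.Probability.RandomPlanarGeometry.SAW.IsEmbEndpointApprox Literature.Probability.LatticeModels.hexGraph 
-- earlier HexObservableLimit (stmt-CriticalPhenomena-5420, replaced 2026-08-16T00:10:46Z -> stmt-CriticalPhenomena-14003): refuted by Summit.CriticalPhenomena.SAWScalingLimit.Theorems.SAWDefectDecoherenceHexObservableLimit_refuted @ b90fe791a4c9 — ∃ c : ℂ, c ≠ 0 ∧ ∀ (D : Literature.Probability.RandomPlanarGeometry.DobrushinDomain) (ρ : ℝ) (Λ : ℝ → Finset Literature.Probability.LatticeModels.HexVerte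
-- earlier HarmonicPartLimit (stmt-CriticalPhenomena-5422, replaced 2026-08-16T00:10:46Z -> stmt-CriticalPhenomena-14055): retired by None — ∃ c : ℂ, c ≠ 0 ∧ ∀ (D : Literature.Probability.RandomPlanarGeometry.DobrushinDomain) (ρ : ℝ) (Λ : ℝ → Finset Literature.Probability.LatticeModels.HexVertex) (m : ℝ → ℤ) (a b : ℝ → Sym2 Literature.Probability.LatticeModels.HexVertex) (Φ : Literature.Probability.R
-- earlier ObservableToSLE (stmt-CriticalPhenomena-5424, replaced 2026-08-15T16:18:27Z -> stmt-CriticalPhenomena-10472): retired by None — HexObservableLimit → HexTight → Literature.Probability.RandomPlanarGeometry.SAW.HexSAWScalingLimit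
-- earlier Synthesis (stmt-CriticalPhenomena-5427, replaced 2026-08-16T00:11:33Z -> stmt-CriticalPhenomena-14056): retired by None — ResidueExists → ResidueEnergyVanishes → HarmonicPartLimit → HexObservableLimit
-- earlier HexToSquare (stmt-CriticalPhenomena-5428, replaced 2026-08-15T16:18:27Z -> stmt-CriticalPhenomena-10473): retired by None — Literature.Probability.RandomPlanarGeometry.SAW.HexSAWScalingLimit → LatticeUniversality → SAWScalingLimit

/-! D-0027 §2.1 — DECIDING THEOREM (planner-authored via `route open/edit --closes-file`; by planner-rchoice-CriticalPhenomena-SAWResidueFi-57937f86-g2-0 2026-08-16T04:05:19Z):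
its hypotheses are this route's items and its conclusion the sub-problem Statement (glue_lint), and it elaborates with this file. -/

@[closes "route-CriticalPhenomena-SAWResidueField"] theorem closes (hR : ResidueEnergyVanishes) (hH : HarmonicPartLimitR) (hS : SynthesisR)
    (hT : HexTight) (hO : ObservableToSLER) (hE : HexEndpointApproxExists) (hSq : SquareTransfer)
    (hU : LatticeUniversality) : _root_.SAWScalingLimit :=
  -- layer 1: SynthesisR turns [R] + [H] into the target X; ObservableToSLER turns X + HexTight into
  -- DCS Conjecture 1 on the hexagonal lattice (written out); layer 2: SquareTransfer transports it to
  -- δℤ² with the hexagonal endpoint approximation of HexEndpointApproxExists and LatticeUniversality.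
  hSq hE (hO (hS hR hH) hT) hU

end Summit.CriticalPhenomena.SAWScalingLimit.Theses.SAWResidueField
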